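import Literature.Topology.FourManifolds.MMSWRasmussenFacts
import Literature.Topology.FourManifolds.DehnSurgery
import Literature.Topology.FourManifolds.KirbyMoves
import Literature.Topology.FourManifolds.ZeroSurgeryHomotopyBallSliceConstruction
import Summits.SmoothPoincare4.SmoothPoincare4.Theses.DottedCircleRasmussen
import Summits.SmoothPoincare4.SmoothPoincare4.Theorems.DottedCircleRasmussenDcrGapHelperFriendsCarrierExterior
import Summits.SmoothPoincare4.SmoothPoincare4.Theorems.DottedCircleRasmussenDcrGapHelperFriendsCarrierInversion
import Literature.Topology.FourManifolds.MMSWPictureSurgery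

/-!
# Stub `stub_friendsCarrier` (A, the carrier) of line `mk_friends` for crux `DcrGap`: the gluing reduction
(item stmt-SmoothPoincare4-16128, route route-SmoothPoincare4-DottedCircleRasmussen)

Stub A of the skeleton `Lines/mk_friends.lean` (v3) asks, from an `M_k`-friends datum WITHOUT the kernel
condition — two model knots `K₀`, `K₁` on the model boundary `M_k = ∂D_k = MMSW.modelBoundary k`
missing the core circles, `K₁` null-homologous with a NEAT model slice disc `f₁` off `D_k`
(`MMSW.IsModelSliceDisc` + the sign clause) and a trivialised tube `T` of `f₁` off `D_k`, the two
framed picture links `L_i = U⁰ ⊔ D(0⃗)(K_i)⁰` (the `k` round dotted circles of the standard picture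
`MMSW.draw` and the picture `MMSW.finiteApprox k 0 K_i`, all framings `0`), ONE `T₂` second-countable
smooth `3`-manifold `Y` presented as surgery on `S³` along both (`jA_i`, `jB_i`, `Link.surgeryRel`), and
the cores `μ_i` of the two last surgery tori (the dual knots) — for the CARRIER: a closed smooth
`4`-manifold `X` (the idea's `X = (D_k ∪_{K₀} h²) ∪_Y (ℝ⁴ ∪ {∞} ∖ (D_k ∪ ν Δ₁))`, `Δ₁ = f₁(𝔻²)`, the
Manolescu–Piccirillo disc-exterior swap one level up) together with a germ chart `i` of `D_k`, the
core disc `f₀` of the `2`-handle (boundary `i ∘ K₀`, collar band `g₀`, sign clause), a smooth open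
embedding `j` of the model disc exterior `E = ℝ⁴ ∖ (D_k ∪ Δ₁)` onto the complement of the core and of
one point `q` with `j → q` at infinity, the map `c : Y → X`, the tube meridian `m v = T (0, v/2)` of
`Δ₁` and the loop `ℓ = j ∘ m`, and the two homotopy clauses (6a) `c ∘ μ₀ ≃ const` and
(6b) `c ∘ μ₁ ≃ const → ℓ ≃ const`.

## What is PROVED here: the gluing step `G_k`, as the reduction `P_k → T_k → V_k → A`

`helper_friendsCarrier_of_collars` (its statement is the three inputs, verbatim, implying stub A
verbatim; at 22 k characters it exceeds the gate's cap for registered stub signatures, so the file's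
registered helper is the short `helper_friendsCarrier_tubeMeridian`) and `stub_friendsCarrier_of_collars`
(the same with the inputs as named hypotheses) close stub A MODULO three inputs — the `k ≥ 1` analogues
of the tree's PROVED `k = 0` template `Knot.ManolescuPiccirillo2023_lemma33_sphere_construction_of_collars`
(`Literature/Topology/FourManifolds/ZeroSurgeryHomotopyBallSliceConstruction.lean`: open trace and
slice-disc end collar glued along `Y × ℝ`):

* `P_k` = the named literature fact `pictureSurgeryPresentation` (stated inline below, cited, for
  relocation under `Literature/Topology/FourManifolds/`): Kirby's Lemma 2.1 (dotted circle ↔ `0`-framed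
  unknot on the boundary) read in MMSW's standard picture — the `S³`-presentation of `Y` along
  `U⁰ ⊔ D(0⃗)(K)⁰` is re-presented as ONE surgery on `M_k` along `K`, by a tube of `K` off the cores whose
  picture is `0`-framed, with the new solid torus having literally the core of the last surgery torus;
* `T_k` = the registered helper stub `helper_friendsCarrier_Tk` (statement only, open; registered with
  namespaces opened, the same proposition as the hypothesis below by `rfl`): the relative open trace — from `Y` presented as surgery on `M_k` along `K₀` (any tube `νK`) with tracked core `μ₀`, a smooth
  `T₂` `4`-manifold with a germ chart of `D_k`, the core disc of the `2`-handle attached along `νK`, an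
  open collar `c_T : Y × ℝ ≅ (complement of the core)` with the closedness/compactness clauses that
  `SmoothGlueData.ofCollars` wants, and every loop `v ↦ c_T (μ₀ v, 0)` null-homotopic (the pushed dual
  knot is the belt circle; it bounds the cocore);
* `V_k` = the registered helper stub `helper_friendsCarrier_Vk` (statement only, open; registered
  likewise): the `Y`-collared end of the inverted model disc exterior `F = {0} ∪ ι(E)`, `ι y = y/‖y‖²` — from `Y` presented as surgery
  on `M_k` along `K₁` with tracked core `μ₁` by a tube off the cores whose picture is `0`-framed, an open
  collar `c_V : Y × ℝ →` (end of `F` at `ι(D_k ∪ Δ₁)`) with the dual closedness/compactness clauses, under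
  which the pushed dual knot `v ↦ c_V (μ₁ v, 0)` dies under every map `g : F → Z` only if the inverted tube
  meridian `v ↦ ι (T (0, v/2))` does (both are meridians of `Δ₁` up to free homotopy; the disc framing of
  `K₁ = ∂Δ₁` IS the picture `0`-framing because `K₁` is null-homologous: the class `Σ` of `Δ₁` capped
  off in `D_k` generates `H₂(D_k ∪ ν Δ₁)` and has `Σ · Σ = 0` in `S⁴ ⊃ D_k ∪ ν Δ₁`, while the
  diagram framing coefficient of a `2`-handle going algebraically zero times over the `1`-handles is
  `Σ · Σ` — Kirby Ch. I §2 and Ch. II §1).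

Proof of the reduction (≈ 180 lines): apply `P_k` to both presentations (so `μ_i` are the cores of
the two new solid tori), `T_k` to the `K₀`-presentation and `V_k` to the `K₁`-presentation, with `E`, `F`
the `Opens` of `helper_friendsCarrier_exterior` and the chart at infinity `ι : E → F` of
`helper_friendsCarrier_inversion` (both landed); glue the trace `T` and `F` along the two collars by
`SmoothGlueData.ofCollars` (Hausdorff: `t2Space_ofCollars`; compact: `compactSpace_ofCollars`; second
countable; Kosinski VI §5 "identify `(x, t)` with `(x, 1/t)`"); then `i := inl ∘ i_T`, `f₀ := inl ∘ f₀_T`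
(injective differentials transported through the immersion `inl`,
`Manifold.IsImmersionAtOfComplement.mfderiv_injective`), `j := inr ∘ ι`, `q := inr 0`,
`range j = (inl '' core ∪ {q})ᶜ` by `range_inr_ofCollars`, `c y := inl (c_T (y, 0))`,
`ℓ v := inr (ι (m v))` — the tube meridian lies in `E`: `T` misses `D_k`, and `T (0, v/2) ∉ f₁(𝔻²)` by
injectivity of `T` on the tube (`T (x, 0) = f₁ x`) and `f₁|∂𝔻² = K₁ ⊂ M_k ⊂ D_k`; (6a) is `inl ∘` the last
clause of `T_k`; (6b) rewrites `c ∘ μ₁ = inr ∘ c_V (μ₁ ·, 0)` across the neck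
(`SmoothGlueData.inl_collar_eq_inr_collar`) and applies the last clause of `V_k` with `g := inr`.

## What is NOT here

No proof of `P_k` (cited Literature debt), `T_k`, `V_k` (open registered helper stubs: XL differential
topology, the `k ≥ 1` versions of the tree's `OpenTrace*.lean` / `SliceDiscEndCollar*.lean` without the
radial cone structure of `S³ ⊂ ℝ⁴`).  With this file stub A is closed modulo exactly
`{Literature.Topology.FourManifolds.pictureSurgeryPresentation, helper_friendsCarrier_Tk, helper_friendsCarrier_Vk}`.

References: R. Kirby, *The Topology of 4-Manifolds*, LNM 1374 (1989), Ch. I §2 and Lemma 2.1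
[Kirby1989]; C. Manolescu, M. Marengon, S. Sarkar, M. Willis, *A generalization of Rasmussen's
invariant …*, Duke Math. J. 172 (2023), Def. 8.26 / Remark 8.27 (standard diagrams of `#ʳ(S¹ × S²)`)
[ManolescuMarengonSarkarWillis2023]; C. Manolescu, L. Piccirillo, *From zero surgeries to candidates
for exotic definite 4-manifolds*, J. Lond. Math. Soc. 108 (2023), §3.2, proof of Lemma 3.3
(`X = X₀(K') ∪_Y (W ∖ ν(Δ))`) [ManolescuPiccirillo2023]; A. Kosinski, *Differential Manifolds* (1993),
Ch. VI §5 (gluing along collars) [Kosinski1993].  No `sorry`.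
-/

-- the prescribed namespace `Summit.<P>.<Sub>.…` duplicates `SmoothPoincare4` (P = Sub)
set_option linter.dupNamespace false
-- registered stub signatures are one-line `Prop` terms matched verbatim by the gate, hence the long lines
set_option linter.style.longLine false

noncomputable section

-- `_root_`: these lines travel with the relocated fact into `namespace Literature.Topology.FourManifolds`,
-- where bare `Manifold`/`Topology` would resolve to shadowing sub-namespaces (CONVENTIONS §2)
open scoped _root_.Manifold _root_.ContDiff _root_.Topology
open _root_.Function _root_.Set
open Literature.Topology.FourManifolds Literature.Topology.FourManifolds.MMSW

namespace Summit.SmoothPoincare4.SmoothPoincare4.Theorems.DcrGap.MkFriends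

/-- **The tube meridian lies in the model disc exterior** (registered helper stub
`helper_friendsCarrier_tubeMeridian`; clause `m v = T (0, v/2)` of stub A).  For a model slice disc
`f₁` of the model knot `K₁` and a tube `T` of `f₁` off `D_k` — injective on
`B(0, 1) × B(0, 2)`, missing `MMSW.modelHandlebody k` there, `T (x, 0) = f₁ x` on the open disc — the
meridian circle `v ↦ T (0, v/2)` of `Δ₁ = f₁(𝔻²)` misses `D_k` (a tube clause) and misses `Δ₁`: a point
`T (0, v/2) = f₁ x` with `‖x‖ < 1` would give `(x, 0) = (0, v/2)` by injectivity of `T`, and with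
`‖x‖ = 1` would put it at `K₁ x ∈ ∂D_k ⊆ D_k` (`MMSW.IsModelSliceDisc`: `f₁|∂𝔻² = K₁`). [folklore] -/
theorem helper_friendsCarrier_tubeMeridian : ∀ (k : ℕ) (K₁ : (Metric.sphere (0 : EuclideanSpace ℝ (Fin 2)) 1) → EuclideanSpace ℝ (Fin 4)) (f₁ : EuclideanSpace ℝ (Fin 2) → EuclideanSpace ℝ (Fin 4)) (T : EuclideanSpace ℝ (Fin 2) × EuclideanSpace ℝ (Fin 2) → EuclideanSpace ℝ (Fin 4)), Literature.Topology.FourManifolds.MMSW.IsModelKnot k K₁ → Literature.Topology.FourManifolds.MMSW.IsModelSliceDisc k K₁ f₁ → (ContDiffOn ℝ ((⊤ : ℕ∞) : WithTop ℕ∞) T (Metric.ball (0 : EuclideanSpace ℝ (Fin 2)) 1 ×ˢ Metric.ball (0 : EuclideanSpace ℝ (Fin 2)) 2) ∧ Set.InjOn T (Metric.ball (0 : EuclideanSpace ℝ (Fin 2)) 1 ×ˢ Metric.ball (0 : EuclideanSpace ℝ (Fin 2)) 2) ∧ (∀ q ∈ Metric.ball (0 : EuclideanSpace ℝ (Fin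 2)) 1 ×ˢ Metric.ball (0 : EuclideanSpace ℝ (Fin 2)) 2, Function.Injective (fderiv ℝ T q)) ∧ (∀ q ∈ Metric.ball (0 : EuclideanSpace ℝ (Fin 2)) 1 ×ˢ Metric.ball (0 : EuclideanSpace ℝ (Fin 2)) 2, T q ∉ Literature.Topology.FourManifolds.MMSW.modelHandlebody k) ∧ (∀ x ∈ Metric.ball (0 : EuclideanSpace ℝ (Fin 2)) 1, T (x, 0) = f₁ x)) → ∀ v : (Metric.sphere (0 : EuclideanSpace ℝ (Fin 2)) 1), T ((0 : EuclideanSpace ℝ (Fin 2)), (1 / 2 : ℝ) • (v : EuclideanSpace ℝ (Fin 2))) ∉ Literature.Topology.FourManifolds.MMSW.modelHandlebody k ∧ T ((0 : EuclideanSpace ℝ (Fin 2)), (1 / 2 : ℝ) • (v : EuclideanSpace ℝ (Fin 2))) ∉ f₁ '' Metric.closedBall (0 : EuclideanSpace ℝ (Fin 2)) 1 := by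
  intro k K₁ f₁ T hK₁ hf₁ hTube v
  obtain ⟨-, hTinj, -, hTout, hTf⟩ := hTube
  have hq2 : ((0 : EuclideanSpace ℝ (Fin 2)), (1 / 2 : ℝ) • (v : EuclideanSpace ℝ (Fin 2))) ∈
      Metric.ball (0 : EuclideanSpace ℝ (Fin 2)) 1 ×ˢ Metric.ball (0 : EuclideanSpace ℝ (Fin 2)) 2 := by
    refine ⟨by simp, ?_⟩
    rw [mem_ball_zero_iff, norm_smul, norm_eq_of_mem_sphere v]
    norm_num
  refine ⟨hTout _ hq2, ?_⟩
  rintro ⟨x, hx, hfx⟩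
  by_cases h1 : ‖x‖ < 1
  · have hx' : (x, (0 : EuclideanSpace ℝ (Fin 2))) ∈
        Metric.ball (0 : EuclideanSpace ℝ (Fin 2)) 1 ×ˢ Metric.ball (0 : EuclideanSpace ℝ (Fin 2)) 2 :=
      ⟨mem_ball_zero_iff.2 h1, by simp⟩
    have h := hTinj hx' hq2 (by rw [hTf x (mem_ball_zero_iff.2 h1), hfx])
    have h2 : (1 / 2 : ℝ) • (v : EuclideanSpace ℝ (Fin 2)) = 0 := (congrArg Prod.snd h).symm
    rw [smul_eq_zero] at h2
    rcases h2 with h2 | h2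
    · norm_num at h2
    · exact ne_zero_of_mem_unit_sphere v h2
  · have hx1 : ‖x‖ = 1 := le_antisymm (mem_closedBall_zero_iff.1 hx) (not_lt.1 h1)
    have hxS : x ∈ Metric.sphere (0 : EuclideanSpace ℝ (Fin 2)) 1 := by simp [hx1]
    have hb : f₁ x = K₁ ⟨x, hxS⟩ := hf₁.2.2.2.2 ⟨x, hxS⟩
    have hmem : T ((0 : EuclideanSpace ℝ (Fin 2)), (1 / 2 : ℝ) • (v : EuclideanSpace ℝ (Fin 2))) ∈
        modelHandlebody k := by
      rw [← hfx, hb]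
      exact modelBoundary_subset_modelHandlebody (hK₁.mem _)
    exact hTout _ hq2 hmem

/-- **The gluing reduction `P_k → T_k → V_k → A` (helper `helper_friendsCarrier_of_collars` of item
stmt-SmoothPoincare4-16128, line `mk_friends`, stub A).**
Hypotheses, verbatim: `P_k` = `pictureSurgeryPresentation` (Kirby's Lemma 2.1 in the picture),
`T_k` = `helper_friendsCarrier_Tk` (relative open trace with `Y`-collared end and null-homotopic
pushed dual knot), `V_k` = `helper_friendsCarrier_Vk` (`Y`-collared end of the inverted model disc
exterior, pushed dual knot ≃ inverted tube meridian up to what any map sees); conclusion, verbatim: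
stub `stub_friendsCarrier` (v3).  Proof: re-present `Y` twice by `P_k`; take the trace side from `T_k`
at `K₀` and the exterior side from `V_k` at `K₁` on the `Opens` `E`, `F` of
`helper_friendsCarrier_exterior` with the inversion chart `ι` of `helper_friendsCarrier_inversion`;
glue along the collars (`SmoothGlueData.ofCollars`, `t2Space_ofCollars`, `compactSpace_ofCollars`,
`range_inr_ofCollars`, `inl_collar_eq_inr_collar`); read off `i = inl ∘ i_T`, `f₀ = inl ∘ f₀_T`,
`j = inr ∘ ι`, `q = inr 0`, `c = inl ∘ c_T (·, 0)`, `m v = T (0, v/2)` (it lies in `E`),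
`ℓ = inr ∘ ι ∘ m`, (6a) from `T_k`, (6b) from `V_k` with `g = inr` across the neck.  The `k = 0`
template is `Knot.ManolescuPiccirillo2023_lemma33_sphere_construction_of_collars`.
[cite: ManolescuPiccirillo2023, §3.2, proof of Lemma 3.3] [cite: Kosinski1993, Ch. VI §5] -/
theorem helper_friendsCarrier_of_collars : (∀ (k : ℕ) (K : (Metric.sphere (0 : EuclideanSpace ℝ (Fin 2)) 1) → EuclideanSpace ℝ (Fin 4)), Literature.Topology.FourManifolds.MMSW.IsModelKnot k K → (∀ t, Literature.AlgebraicTopology.Homotopy.HopfFibration.wC (K t) ≠ 0) → ∀ (L : Literature.Topology.FourManifolds.FramedLink (Fin (k + 1))), ((∀ j : Fin k, ⇑(L.component j.castSucc) = fun θ : (Metric.sphere (0 : EuclideanSpace ℝ (Fin 2)) 1) => Literature.Topology.FourManifolds.MMSW.toSphereThree ((4 * (((j : ℕ) : ℝ) + 1) + Literature.Topology.FourManifolds.MMSW.drawRadius k) * (θ : EuclideanSpace ℝ (Fin 2)) 0, (4 * (((j : ℕ) : ℝ) + 1) + Literature.Topology.FourManifolds.MMSW.drawRadius k) * (θ : EuclideanSpace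 ℝ (Fin 2)) 1) 0) ∧ ⇑(L.component (Fin.last k)) = Literature.Topology.FourManifolds.MMSW.finiteApprox k 0 K ∧ (∀ i, L.framing i = 0)) → ∀ (Y : Type) [TopologicalSpace Y] [T2Space Y] [SecondCountableTopology Y] [ChartedSpace (EuclideanSpace ℝ (Fin 3)) Y] [IsManifold (𝓡 3) ((⊤ : ℕ∞) : WithTop ℕ∞) Y] (jA : L.toLink.complement → Y) (jB : Fin (k + 1) → Literature.Topology.FourManifolds.solidTorus → Y), (∃ ν : ∀ i, Literature.Topology.FourManifolds.Knot.TubularNbhd (L.component i), (∀ i, (ν i).HasFraming (L.framing i)) ∧ (Pairwise fun i i' => Disjoint (Set.range (ν i)) (Set.range (ν i'))) ∧ Manifold.IsSmoothEmbedding (𝓡 3) (𝓡 3) ((⊤ : ℕ∞) : WithTop ℕ∞) jA ∧ IsOpen (Set.range jA) ∧ (∀ i, Manifold.IsSmoothEmbedding (𝓘(ℝ, EuclideanSpace ℝ (Fin 2)).prod (𝓡 1)) (𝓡 3) ((⊤ : ℕ∞) : WithTop ℕ∞) (jB i) ∧ IsOpen (Set.range (jB i))) ∧ Set.range jA ∪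 (⋃ i, Set.range (jB i)) = Set.univ ∧ (Pairwise fun i i' => Disjoint (Set.range (jB i)) (Set.range (jB i'))) ∧ ∀ i a b, jA a = jB i b ↔ Literature.Topology.FourManifolds.Link.surgeryRel ν i a b) → ∃ (jBl : Literature.Topology.FourManifolds.solidTorus → Y) (νK : (Metric.sphere (0 : EuclideanSpace ℝ (Fin 2)) 1) × EuclideanSpace ℝ (Fin 2) → EuclideanSpace ℝ (Fin 4)) (jM : EuclideanSpace ℝ (Fin 4) → Y) (W : Set (EuclideanSpace ℝ (Fin 4))) (ψ : Y → EuclideanSpace ℝ (Fin 4)) (ν' : Literature.Topology.FourManifolds.Knot.TubularNbhd (L.component (Fin.last k))) (r : ℝ), (Manifold.IsSmoothEmbedding (𝓘(ℝ, EuclideanSpace ℝ (Fin 2)).prod (𝓡 1)) (𝓡 3) ((⊤ : ℕ∞) : WithTop ℕ∞) jBl ∧ IsOpen (Set.range jBl) ∧ ContMDiff ((𝓡 1).prod 𝓘(ℝ, EuclideanSpace ℝ (Fin 2))) 𝓘(ℝ, EuclideanSpace ℝ (Fin 4)) ((⊤ : ℕ∞) : WithTop ℕ∞) νK ∧ Function.Injective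 νK ∧ (∀ p, Function.Injective (mfderiv ((𝓡 1).prod 𝓘(ℝ, EuclideanSpace ℝ (Fin 2))) 𝓘(ℝ, EuclideanSpace ℝ (Fin 4)) νK p)) ∧ (∀ p, νK p ∈ Literature.Topology.FourManifolds.MMSW.modelBoundary k) ∧ (∀ u : (Metric.sphere (0 : EuclideanSpace ℝ (Fin 2)) 1), νK (u, 0) = K u) ∧ IsOpen W ∧ (∀ x ∈ Literature.Topology.FourManifolds.MMSW.modelBoundary k, x ∉ Set.range K → x ∈ W) ∧ ContMDiffOn 𝓘(ℝ, EuclideanSpace ℝ (Fin 4)) (𝓡 3) ((⊤ : ℕ∞) : WithTop ℕ∞) jM W ∧ IsOpen (jM '' {x : EuclideanSpace ℝ (Fin 4) | x ∈ Literature.Topology.FourManifolds.MMSW.modelBoundary k ∧ x ∉ Set.range K}) ∧ ContMDiffOn (𝓡 3) 𝓘(ℝ, EuclideanSpace ℝ (Fin 4)) ((⊤ : ℕ∞) : WithTop ℕ∞) ψ (jM '' {x : EuclideanSpace ℝ (Fin 4) | x ∈ Literature.Topology.FourManifolds.MMSW.modelBoundary k ∧ x ∉ Set.range K}) ∧ (∀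 x ∈ Literature.Topology.FourManifolds.MMSW.modelBoundary k, x ∉ Set.range K → ψ (jM x) = x) ∧ jM '' {x : EuclideanSpace ℝ (Fin 4) | x ∈ Literature.Topology.FourManifolds.MMSW.modelBoundary k ∧ x ∉ Set.range K} ∪ Set.range jBl = Set.univ ∧ (∀ x ∈ Literature.Topology.FourManifolds.MMSW.modelBoundary k, x ∉ Set.range K → ∀ b : Literature.Topology.FourManifolds.solidTorus, jM x = jBl b ↔ ∃ (u : (Metric.sphere (0 : EuclideanSpace ℝ (Fin 2)) 1)) (t : ℝ), t ∈ Set.Ioo (0 : ℝ) 1 ∧ (b : EuclideanSpace ℝ (Fin 2) × (Metric.sphere (0 : EuclideanSpace ℝ (Fin 2)) 1)).1 = t • (u : EuclideanSpace ℝ (Fin 2)) ∧ x = νK (u, t • ((b : EuclideanSpace ℝ (Fin 2) × (Metric.sphere (0 : EuclideanSpace ℝ (Fin 2)) 1)).2 : EuclideanSpace ℝ (Fin 2))))) ∧ (∀ b : Literature.Topology.FourManifolds.solidTorus, (b : EuclideanSpace ℝ (Fin 2) × (Metric.sphere (0 : EuclideanSpace ℝ (Fin 2)) 1)).1 = 0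 → jBl b = jB (Fin.last k) b) ∧ (∀ p, Literature.AlgebraicTopology.Homotopy.HopfFibration.wC (νK p) ≠ 0) ∧ ν'.HasFraming 0 ∧ 0 < r ∧ (∀ (u : (Metric.sphere (0 : EuclideanSpace ℝ (Fin 2)) 1)) (w : EuclideanSpace ℝ (Fin 2)), ‖w‖ < 1 → Literature.Topology.FourManifolds.MMSW.toSphereThree (Literature.Topology.FourManifolds.MMSW.draw k (νK (u, w))).1 (Literature.Topology.FourManifolds.MMSW.draw k (νK (u, w))).2 = ν' (u, r • w))) → (∀ (k : ℕ) (K₀ : (Metric.sphere (0 : EuclideanSpace ℝ (Fin 2)) 1) → EuclideanSpace ℝ (Fin 4)), Literature.Topology.FourManifolds.MMSW.IsModelKnot k K₀ → ∀ (Y : Type) [TopologicalSpace Y] [T2Space Y] [SecondCountableTopology Y] [ChartedSpace (EuclideanSpace ℝ (Fin 3)) Y] [IsManifold (𝓡 3) ((⊤ : ℕ∞) : WithTop ℕ∞) Y] (jB : Literature.Topology.FourManifolds.solidTorus → Y) (μ₀ : C((Metric.sphere (0 : EuclideanSpace ℝ (Fin 2)) 1), Y)) (νK : (Metric.sphere (0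 : EuclideanSpace ℝ (Fin 2)) 1) × EuclideanSpace ℝ (Fin 2) → EuclideanSpace ℝ (Fin 4)) (jM : EuclideanSpace ℝ (Fin 4) → Y) (W : Set (EuclideanSpace ℝ (Fin 4))) (ψ : Y → EuclideanSpace ℝ (Fin 4)), (Manifold.IsSmoothEmbedding (𝓘(ℝ, EuclideanSpace ℝ (Fin 2)).prod (𝓡 1)) (𝓡 3) ((⊤ : ℕ∞) : WithTop ℕ∞) jB ∧ IsOpen (Set.range jB) ∧ ContMDiff ((𝓡 1).prod 𝓘(ℝ, EuclideanSpace ℝ (Fin 2))) 𝓘(ℝ, EuclideanSpace ℝ (Fin 4)) ((⊤ : ℕ∞) : WithTop ℕ∞) νK ∧ Function.Injective νK ∧ (∀ p, Function.Injective (mfderiv ((𝓡 1).prod 𝓘(ℝ, EuclideanSpace ℝ (Fin 2))) 𝓘(ℝ, EuclideanSpace ℝ (Fin 4)) νK p)) ∧ (∀ p, νK p ∈ Literature.Topology.FourManifolds.MMSW.modelBoundary k) ∧ (∀ u : (Metric.sphere (0 : EuclideanSpace ℝ (Fin 2)) 1), νK (u, 0) = K₀ u) ∧ IsOpen W ∧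 (∀ x ∈ Literature.Topology.FourManifolds.MMSW.modelBoundary k, x ∉ Set.range K₀ → x ∈ W) ∧ ContMDiffOn 𝓘(ℝ, EuclideanSpace ℝ (Fin 4)) (𝓡 3) ((⊤ : ℕ∞) : WithTop ℕ∞) jM W ∧ IsOpen (jM '' {x : EuclideanSpace ℝ (Fin 4) | x ∈ Literature.Topology.FourManifolds.MMSW.modelBoundary k ∧ x ∉ Set.range K₀}) ∧ ContMDiffOn (𝓡 3) 𝓘(ℝ, EuclideanSpace ℝ (Fin 4)) ((⊤ : ℕ∞) : WithTop ℕ∞) ψ (jM '' {x : EuclideanSpace ℝ (Fin 4) | x ∈ Literature.Topology.FourManifolds.MMSW.modelBoundary k ∧ x ∉ Set.range K₀}) ∧ (∀ x ∈ Literature.Topology.FourManifolds.MMSW.modelBoundary k, x ∉ Set.range K₀ → ψ (jM x) = x) ∧ jM '' {x : EuclideanSpace ℝ (Fin 4) | x ∈ Literature.Topology.FourManifolds.MMSW.modelBoundary k ∧ x ∉ Set.range K₀} ∪ Set.range jB = Set.univ ∧ (∀ x ∈ Literature.Topology.FourManifolds.MMSW.modelBoundary k, x ∉ Set.range K₀ →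 ∀ b : Literature.Topology.FourManifolds.solidTorus, jM x = jB b ↔ ∃ (u : (Metric.sphere (0 : EuclideanSpace ℝ (Fin 2)) 1)) (t : ℝ), t ∈ Set.Ioo (0 : ℝ) 1 ∧ (b : EuclideanSpace ℝ (Fin 2) × (Metric.sphere (0 : EuclideanSpace ℝ (Fin 2)) 1)).1 = t • (u : EuclideanSpace ℝ (Fin 2)) ∧ x = νK (u, t • ((b : EuclideanSpace ℝ (Fin 2) × (Metric.sphere (0 : EuclideanSpace ℝ (Fin 2)) 1)).2 : EuclideanSpace ℝ (Fin 2))))) → (∀ (v : (Metric.sphere (0 : EuclideanSpace ℝ (Fin 2)) 1)) (b : Literature.Topology.FourManifolds.solidTorus), (b : EuclideanSpace ℝ (Fin 2) × (Metric.sphere (0 : EuclideanSpace ℝ (Fin 2)) 1)) = ((0 : EuclideanSpace ℝ (Fin 2)), v) → μ₀ v = jB b) → ∃ (X : Type) (_ : TopologicalSpace X) (_ : T2Space X) (_ : ChartedSpace (EuclideanSpace ℝ (Fin 4)) X) (_ : IsManifold (𝓡 4) ((⊤ : ℕ∞) : WithTop ℕ∞) X) (U : Set (EuclideanSpace ℝ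 (Fin 4))) (i : EuclideanSpace ℝ (Fin 4) → X) (f₀ : EuclideanSpace ℝ (Fin 2) → X) (g₀ : EuclideanSpace ℝ (Fin 2) → EuclideanSpace ℝ (Fin 4)) (c : OpenPartialHomeomorph (Y × ℝ) X), (IsOpen U ∧ Literature.Topology.FourManifolds.MMSW.modelHandlebody k ⊆ U ∧ ContMDiffOn (𝓡 4) (𝓡 4) ((⊤ : ℕ∞) : WithTop ℕ∞) i U ∧ Set.InjOn i U ∧ (∀ x ∈ U, Function.Injective (mfderiv (𝓡 4) (𝓡 4) i x))) ∧ (ContMDiff (𝓡 2) (𝓡 4) ((⊤ : ℕ∞) : WithTop ℕ∞) f₀ ∧ Set.InjOn f₀ (Metric.closedBall (0 : EuclideanSpace ℝ (Fin 2)) 1) ∧ (∀ x ∈ Metric.closedBall (0 : EuclideanSpace ℝ (Fin 2)) 1, Function.Injective (mfderiv (𝓡 2) (𝓡 4) f₀ x)) ∧ (∀ x : EuclideanSpace ℝ (Fin 2), ‖x‖ < 1 → f₀ x ∉ i '' Literature.Topology.FourManifolds.MMSW.modelHandlebody k) ∧ (∀ t : (Metric.sphere (0 : EuclideanSpace ℝ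 (Fin 2)) 1), f₀ t = i (K₀ t)) ∧ ContDiff ℝ ((⊤ : ℕ∞) : WithTop ℕ∞) g₀ ∧ (∃ η : ℝ, 0 < η ∧ (∀ x : EuclideanSpace ℝ (Fin 2), 1 - η < ‖x‖ → ‖x‖ ≤ 1 → g₀ x ∈ U ∧ f₀ x = i (g₀ x))) ∧ (∀ t : (Metric.sphere (0 : EuclideanSpace ℝ (Fin 2)) 1), deriv (fun ρ : ℝ => Literature.Topology.FourManifolds.MMSW.levelFun k (g₀ (ρ • (t : EuclideanSpace ℝ (Fin 2))))) 1 < 0)) ∧ c.source = Set.univ ∧ ContMDiffOn ((𝓡 3).prod 𝓘(ℝ, ℝ)) (𝓡 4) ((⊤ : ℕ∞) : WithTop ℕ∞) c c.source ∧ ContMDiffOn (𝓡 4) ((𝓡 3).prod 𝓘(ℝ, ℝ)) ((⊤ : ℕ∞) : WithTop ℕ∞) c.symm c.target ∧ c.target = (i '' Literature.Topology.FourManifolds.MMSW.modelHandlebody k ∪ f₀ '' Metric.closedBall (0 : EuclideanSpace ℝ (Fin 2)) 1)ᶜ ∧ (∀ a : ℝ, IsCompact ((i '' Literature.Topology.FourManifolds.MMSW.modelHandlebody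 k ∪ f₀ '' Metric.closedBall (0 : EuclideanSpace ℝ (Fin 2)) 1) ∪ c '' {p | p.2 ≤ a})) ∧ (∀ a : ℝ, IsClosed (c '' {p | a ≤ p.2})) ∧ ∀ L₀ : C((Metric.sphere (0 : EuclideanSpace ℝ (Fin 2)) 1), X), (∀ v, L₀ v = c (μ₀ v, 0)) → ∃ x₀ : X, L₀.Homotopic (ContinuousMap.const (Metric.sphere (0 : EuclideanSpace ℝ (Fin 2)) 1) x₀)) → (∀ (k : ℕ) (K₁ : (Metric.sphere (0 : EuclideanSpace ℝ (Fin 2)) 1) → EuclideanSpace ℝ (Fin 4)) (f₁ : EuclideanSpace ℝ (Fin 2) → EuclideanSpace ℝ (Fin 4)) (T : EuclideanSpace ℝ (Fin 2) × EuclideanSpace ℝ (Fin 2) → EuclideanSpace ℝ (Fin 4)), Literature.Topology.FourManifolds.MMSW.IsModelKnot k K₁ → Literature.Topology.FourManifolds.MMSW.IsNullHomologous k K₁ → (∀ t, Literature.AlgebraicTopology.Homotopy.HopfFibration.wC (K₁ t) ≠ 0) → Literature.Topology.FourManifolds.MMSW.IsModelSliceDisc k K₁ f₁ → (∀ t : (Metric.sphere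 (0 : EuclideanSpace ℝ (Fin 2)) 1), deriv (fun ρ : ℝ => Literature.Topology.FourManifolds.MMSW.levelFun k (f₁ (ρ • (t : EuclideanSpace ℝ (Fin 2))))) 1 < 0) → (ContDiffOn ℝ ((⊤ : ℕ∞) : WithTop ℕ∞) T (Metric.ball (0 : EuclideanSpace ℝ (Fin 2)) 1 ×ˢ Metric.ball (0 : EuclideanSpace ℝ (Fin 2)) 2) ∧ Set.InjOn T (Metric.ball (0 : EuclideanSpace ℝ (Fin 2)) 1 ×ˢ Metric.ball (0 : EuclideanSpace ℝ (Fin 2)) 2) ∧ (∀ q ∈ Metric.ball (0 : EuclideanSpace ℝ (Fin 2)) 1 ×ˢ Metric.ball (0 : EuclideanSpace ℝ (Fin 2)) 2, Function.Injective (fderiv ℝ T q)) ∧ (∀ q ∈ Metric.ball (0 : EuclideanSpace ℝ (Fin 2)) 1 ×ˢ Metric.ball (0 : EuclideanSpace ℝ (Fin 2)) 2, T q ∉ Literature.Topology.FourManifolds.MMSW.modelHandlebody k) ∧ (∀ x ∈ Metric.ball (0 : EuclideanSpace ℝ (Fin 2)) 1, T (x, 0) = f₁ x)) → ∀ (Y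 : Type) [TopologicalSpace Y] [T2Space Y] [SecondCountableTopology Y] [ChartedSpace (EuclideanSpace ℝ (Fin 3)) Y] [IsManifold (𝓡 3) ((⊤ : ℕ∞) : WithTop ℕ∞) Y] (jB : Literature.Topology.FourManifolds.solidTorus → Y) (μ₁ : C((Metric.sphere (0 : EuclideanSpace ℝ (Fin 2)) 1), Y)) (νK : (Metric.sphere (0 : EuclideanSpace ℝ (Fin 2)) 1) × EuclideanSpace ℝ (Fin 2) → EuclideanSpace ℝ (Fin 4)) (jM : EuclideanSpace ℝ (Fin 4) → Y) (W : Set (EuclideanSpace ℝ (Fin 4))) (ψ : Y → EuclideanSpace ℝ (Fin 4)), (Manifold.IsSmoothEmbedding (𝓘(ℝ, EuclideanSpace ℝ (Fin 2)).prod (𝓡 1)) (𝓡 3) ((⊤ : ℕ∞) : WithTop ℕ∞) jB ∧ IsOpen (Set.range jB) ∧ ContMDiff ((𝓡 1).prod 𝓘(ℝ, EuclideanSpace ℝ (Fin 2))) 𝓘(ℝ, EuclideanSpace ℝ (Fin 4)) ((⊤ : ℕ∞) : WithTop ℕ∞) νK ∧ Function.Injective νK ∧ (∀ p, Function.Injective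 (mfderiv ((𝓡 1).prod 𝓘(ℝ, EuclideanSpace ℝ (Fin 2))) 𝓘(ℝ, EuclideanSpace ℝ (Fin 4)) νK p)) ∧ (∀ p, νK p ∈ Literature.Topology.FourManifolds.MMSW.modelBoundary k) ∧ (∀ u : (Metric.sphere (0 : EuclideanSpace ℝ (Fin 2)) 1), νK (u, 0) = K₁ u) ∧ IsOpen W ∧ (∀ x ∈ Literature.Topology.FourManifolds.MMSW.modelBoundary k, x ∉ Set.range K₁ → x ∈ W) ∧ ContMDiffOn 𝓘(ℝ, EuclideanSpace ℝ (Fin 4)) (𝓡 3) ((⊤ : ℕ∞) : WithTop ℕ∞) jM W ∧ IsOpen (jM '' {x : EuclideanSpace ℝ (Fin 4) | x ∈ Literature.Topology.FourManifolds.MMSW.modelBoundary k ∧ x ∉ Set.range K₁}) ∧ ContMDiffOn (𝓡 3) 𝓘(ℝ, EuclideanSpace ℝ (Fin 4)) ((⊤ : ℕ∞) : WithTop ℕ∞) ψ (jM '' {x : EuclideanSpace ℝ (Fin 4) | x ∈ Literature.Topology.FourManifolds.MMSW.modelBoundary k ∧ x ∉ Set.range K₁}) ∧ (∀ x ∈ Literature.Topology.FourManifolds.MMSW.modelBoundary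 k, x ∉ Set.range K₁ → ψ (jM x) = x) ∧ jM '' {x : EuclideanSpace ℝ (Fin 4) | x ∈ Literature.Topology.FourManifolds.MMSW.modelBoundary k ∧ x ∉ Set.range K₁} ∪ Set.range jB = Set.univ ∧ (∀ x ∈ Literature.Topology.FourManifolds.MMSW.modelBoundary k, x ∉ Set.range K₁ → ∀ b : Literature.Topology.FourManifolds.solidTorus, jM x = jB b ↔ ∃ (u : (Metric.sphere (0 : EuclideanSpace ℝ (Fin 2)) 1)) (t : ℝ), t ∈ Set.Ioo (0 : ℝ) 1 ∧ (b : EuclideanSpace ℝ (Fin 2) × (Metric.sphere (0 : EuclideanSpace ℝ (Fin 2)) 1)).1 = t • (u : EuclideanSpace ℝ (Fin 2)) ∧ x = νK (u, t • ((b : EuclideanSpace ℝ (Fin 2) × (Metric.sphere (0 : EuclideanSpace ℝ (Fin 2)) 1)).2 : EuclideanSpace ℝ (Fin 2))))) → (∀ (v : (Metric.sphere (0 : EuclideanSpace ℝ (Fin 2)) 1)) (b : Literature.Topology.FourManifolds.solidTorus), (b : EuclideanSpace ℝ (Fin 2) × (Metric.sphere (0 : EuclideanSpace ℝ (Fin 2))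 1)) = ((0 : EuclideanSpace ℝ (Fin 2)), v) → μ₁ v = jB b) → ∀ (J : Literature.Topology.FourManifolds.Knot) (ν' : Literature.Topology.FourManifolds.Knot.TubularNbhd J) (r : ℝ), (∀ p, Literature.AlgebraicTopology.Homotopy.HopfFibration.wC (νK p) ≠ 0) ∧ ν'.HasFraming 0 ∧ 0 < r ∧ (∀ (u : (Metric.sphere (0 : EuclideanSpace ℝ (Fin 2)) 1)) (w : EuclideanSpace ℝ (Fin 2)), ‖w‖ < 1 → Literature.Topology.FourManifolds.MMSW.toSphereThree (Literature.Topology.FourManifolds.MMSW.draw k (νK (u, w))).1 (Literature.Topology.FourManifolds.MMSW.draw k (νK (u, w))).2 = ν' (u, r • w)) → ∀ (E F : TopologicalSpace.Opens (EuclideanSpace ℝ (Fin 4))), (E : Set (EuclideanSpace ℝ (Fin 4))) = {x | x ∉ Literature.Topology.FourManifolds.MMSW.modelHandlebody k ∧ x ∉ f₁ '' Metric.closedBall (0 : EuclideanSpace ℝ (Fin 2)) 1} → (F : Set (EuclideanSpace ℝ (Fin 4))) = {0} ∪ {y : EuclideanSpace ℝ (Fin 4) | y ≠ 0 ∧ (‖y‖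 ^ 2)⁻¹ • y ∉ Literature.Topology.FourManifolds.MMSW.modelHandlebody k ∧ (‖y‖ ^ 2)⁻¹ • y ∉ f₁ '' Metric.closedBall (0 : EuclideanSpace ℝ (Fin 2)) 1} → ∃ c : OpenPartialHomeomorph (Y × ℝ) F, c.source = Set.univ ∧ ContMDiffOn ((𝓡 3).prod 𝓘(ℝ, ℝ)) (𝓡 4) ((⊤ : ℕ∞) : WithTop ℕ∞) c c.source ∧ ContMDiffOn (𝓡 4) ((𝓡 3).prod 𝓘(ℝ, ℝ)) ((⊤ : ℕ∞) : WithTop ℕ∞) c.symm c.target ∧ (∀ a : ℝ, IsClosed (c '' {q | q.2 ≤ a})) ∧ (∀ a : ℝ, IsCompact (c.targetᶜ ∪ c '' {q | a ≤ q.2})) ∧ ∀ (L₁ L₂ : C((Metric.sphere (0 : EuclideanSpace ℝ (Fin 2)) 1), F)), (∀ v, L₁ v = c (μ₁ v, 0)) → (∀ v : (Metric.sphere (0 : EuclideanSpace ℝ (Fin 2)) 1), ((L₂ v : F) : EuclideanSpace ℝ (Fin 4)) = (‖T ((0 : EuclideanSpace ℝ (Fin 2)), (1 / 2 : ℝ)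 • (v : EuclideanSpace ℝ (Fin 2)))‖ ^ 2)⁻¹ • T ((0 : EuclideanSpace ℝ (Fin 2)), (1 / 2 : ℝ) • (v : EuclideanSpace ℝ (Fin 2)))) → ∀ (Z : Type) [TopologicalSpace Z] (g : C(F, Z)), (∃ z : Z, (g.comp L₁).Homotopic (ContinuousMap.const (Metric.sphere (0 : EuclideanSpace ℝ (Fin 2)) 1) z)) → ∃ z : Z, (g.comp L₂).Homotopic (ContinuousMap.const (Metric.sphere (0 : EuclideanSpace ℝ (Fin 2)) 1) z)) → ∀ (k : ℕ) (K₀ K₁ : (Metric.sphere (0 : EuclideanSpace ℝ (Fin 2)) 1) → EuclideanSpace ℝ (Fin 4)) (f₁ : EuclideanSpace ℝ (Fin 2) → EuclideanSpace ℝ (Fin 4)) (T : EuclideanSpace ℝ (Fin 2) × EuclideanSpace ℝ (Fin 2) → EuclideanSpace ℝ (Fin 4)), Literature.Topology.FourManifolds.MMSW.IsModelKnot k K₀ → (∀ t, Literature.AlgebraicTopology.Homotopy.HopfFibration.wC (K₀ t) ≠ 0) → Literature.Topology.FourManifolds.MMSW.IsModelKnot k K₁ → Literature.Topology.FourManifolds.MMSW.IsNullHomologous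 k K₁ → (∀ t, Literature.AlgebraicTopology.Homotopy.HopfFibration.wC (K₁ t) ≠ 0) → Literature.Topology.FourManifolds.MMSW.IsModelSliceDisc k K₁ f₁ → (∀ t : (Metric.sphere (0 : EuclideanSpace ℝ (Fin 2)) 1), deriv (fun ρ : ℝ => Literature.Topology.FourManifolds.MMSW.levelFun k (f₁ (ρ • (t : EuclideanSpace ℝ (Fin 2))))) 1 < 0) → (ContDiffOn ℝ ((⊤ : ℕ∞) : WithTop ℕ∞) T (Metric.ball (0 : EuclideanSpace ℝ (Fin 2)) 1 ×ˢ Metric.ball (0 : EuclideanSpace ℝ (Fin 2)) 2) ∧ Set.InjOn T (Metric.ball (0 : EuclideanSpace ℝ (Fin 2)) 1 ×ˢ Metric.ball (0 : EuclideanSpace ℝ (Fin 2)) 2) ∧ (∀ q ∈ Metric.ball (0 : EuclideanSpace ℝ (Fin 2)) 1 ×ˢ Metric.ball (0 : EuclideanSpace ℝ (Fin 2)) 2, Function.Injective (fderiv ℝ T q)) ∧ (∀ q ∈ Metric.ball (0 : EuclideanSpace ℝ (Fin 2)) 1 ×ˢ Metric.ball (0 : EuclideanSpace ℝ (Fin 2))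 2, T q ∉ Literature.Topology.FourManifolds.MMSW.modelHandlebody k) ∧ (∀ x ∈ Metric.ball (0 : EuclideanSpace ℝ (Fin 2)) 1, T (x, 0) = f₁ x)) → ∀ (L₀ L₁ : Literature.Topology.FourManifolds.FramedLink (Fin (k + 1))), ((∀ j : Fin k, ⇑(L₀.component j.castSucc) = fun θ : (Metric.sphere (0 : EuclideanSpace ℝ (Fin 2)) 1) => Literature.Topology.FourManifolds.MMSW.toSphereThree ((4 * (((j : ℕ) : ℝ) + 1) + Literature.Topology.FourManifolds.MMSW.drawRadius k) * (θ : EuclideanSpace ℝ (Fin 2)) 0, (4 * (((j : ℕ) : ℝ) + 1) + Literature.Topology.FourManifolds.MMSW.drawRadius k) * (θ : EuclideanSpace ℝ (Fin 2)) 1) 0) ∧ ⇑(L₀.component (Fin.last k)) = Literature.Topology.FourManifolds.MMSW.finiteApprox k 0 K₀ ∧ (∀ i, L₀.framing i = 0)) → ((∀ j : Fin k, ⇑(L₁.component j.castSucc) = fun θ : (Metric.sphere (0 : EuclideanSpace ℝ (Fin 2)) 1) => Literature.Topology.FourManifolds.MMSW.toSphereThree ((4 * (((j : ℕ) : ℝ)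 + 1) + Literature.Topology.FourManifolds.MMSW.drawRadius k) * (θ : EuclideanSpace ℝ (Fin 2)) 0, (4 * (((j : ℕ) : ℝ) + 1) + Literature.Topology.FourManifolds.MMSW.drawRadius k) * (θ : EuclideanSpace ℝ (Fin 2)) 1) 0) ∧ ⇑(L₁.component (Fin.last k)) = Literature.Topology.FourManifolds.MMSW.finiteApprox k 0 K₁ ∧ (∀ i, L₁.framing i = 0)) → ∀ (Y : Type) [TopologicalSpace Y] [T2Space Y] [SecondCountableTopology Y] [ChartedSpace (EuclideanSpace ℝ (Fin 3)) Y] [IsManifold (𝓡 3) ((⊤ : ℕ∞) : WithTop ℕ∞) Y] (jA₀ : L₀.toLink.complement → Y) (jB₀ : Fin (k + 1) → Literature.Topology.FourManifolds.solidTorus → Y) (jA₁ : L₁.toLink.complement → Y) (jB₁ : Fin (k + 1) → Literature.Topology.FourManifolds.solidTorus → Y) (μ₀ μ₁ : C((Metric.sphere (0 : EuclideanSpace ℝ (Fin 2)) 1), Y)), (∃ ν : ∀ i, Literature.Topology.FourManifolds.Knot.TubularNbhd (L₀.component i), (∀ i, (ν i).HasFraming (L₀.framing i)) ∧ (Pairwise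 fun i i' => Disjoint (Set.range (ν i)) (Set.range (ν i'))) ∧ Manifold.IsSmoothEmbedding (𝓡 3) (𝓡 3) ((⊤ : ℕ∞) : WithTop ℕ∞) jA₀ ∧ IsOpen (Set.range jA₀) ∧ (∀ i, Manifold.IsSmoothEmbedding (𝓘(ℝ, EuclideanSpace ℝ (Fin 2)).prod (𝓡 1)) (𝓡 3) ((⊤ : ℕ∞) : WithTop ℕ∞) (jB₀ i) ∧ IsOpen (Set.range (jB₀ i))) ∧ Set.range jA₀ ∪ (⋃ i, Set.range (jB₀ i)) = Set.univ ∧ (Pairwise fun i i' => Disjoint (Set.range (jB₀ i)) (Set.range (jB₀ i'))) ∧ ∀ i a b, jA₀ a = jB₀ i b ↔ Literature.Topology.FourManifolds.Link.surgeryRel ν i a b) → (∃ ν : ∀ i, Literature.Topology.FourManifolds.Knot.TubularNbhd (L₁.component i), (∀ i, (ν i).HasFraming (L₁.framing i)) ∧ (Pairwise fun i i' => Disjoint (Set.range (ν i)) (Set.range (ν i'))) ∧ Manifold.IsSmoothEmbedding (𝓡 3) (𝓡 3) ((⊤ : ℕ∞) : WithTop ℕ∞) jA₁ ∧ IsOpen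 (Set.range jA₁) ∧ (∀ i, Manifold.IsSmoothEmbedding (𝓘(ℝ, EuclideanSpace ℝ (Fin 2)).prod (𝓡 1)) (𝓡 3) ((⊤ : ℕ∞) : WithTop ℕ∞) (jB₁ i) ∧ IsOpen (Set.range (jB₁ i))) ∧ Set.range jA₁ ∪ (⋃ i, Set.range (jB₁ i)) = Set.univ ∧ (Pairwise fun i i' => Disjoint (Set.range (jB₁ i)) (Set.range (jB₁ i'))) ∧ ∀ i a b, jA₁ a = jB₁ i b ↔ Literature.Topology.FourManifolds.Link.surgeryRel ν i a b) → (∀ (v : (Metric.sphere (0 : EuclideanSpace ℝ (Fin 2)) 1)) (b : Literature.Topology.FourManifolds.solidTorus), (b : EuclideanSpace ℝ (Fin 2) × (Metric.sphere (0 : EuclideanSpace ℝ (Fin 2)) 1)) = ((0 : EuclideanSpace ℝ (Fin 2)), v) → μ₀ v = jB₀ (Fin.last k) b) → (∀ (v : (Metric.sphere (0 : EuclideanSpace ℝ (Fin 2)) 1)) (b : Literature.Topology.FourManifolds.solidTorus), (b : EuclideanSpace ℝ (Fin 2) × (Metric.sphere (0 : EuclideanSpace ℝ (Fin 2)) 1))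 = ((0 : EuclideanSpace ℝ (Fin 2)), v) → μ₁ v = jB₁ (Fin.last k) b) → ∃ (X : Type) (_ : TopologicalSpace X) (_ : T2Space X) (_ : SecondCountableTopology X) (_ : ChartedSpace (EuclideanSpace ℝ (Fin 4)) X) (_ : IsManifold (𝓡 4) ((⊤ : ℕ∞) : WithTop ℕ∞) X) (_ : CompactSpace X) (U : Set (EuclideanSpace ℝ (Fin 4))) (i : EuclideanSpace ℝ (Fin 4) → X) (f₀ : EuclideanSpace ℝ (Fin 2) → X) (g₀ : EuclideanSpace ℝ (Fin 2) → EuclideanSpace ℝ (Fin 4)) (E : TopologicalSpace.Opens (EuclideanSpace ℝ (Fin 4))) (j : E → X) (q : X) (c : C(Y, X)) (m : (Metric.sphere (0 : EuclideanSpace ℝ (Fin 2)) 1) → EuclideanSpace ℝ (Fin 4)) (ℓ : C((Metric.sphere (0 : EuclideanSpace ℝ (Fin 2)) 1), X)), (IsOpen U ∧ Literature.Topology.FourManifolds.MMSW.modelHandlebody k ⊆ U ∧ ContMDiffOn (𝓡 4) (𝓡 4) ((⊤ : ℕ∞) : WithTop ℕ∞) i U ∧ Set.InjOn i U ∧ (∀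 x ∈ U, Function.Injective (mfderiv (𝓡 4) (𝓡 4) i x))) ∧ (ContMDiff (𝓡 2) (𝓡 4) ((⊤ : ℕ∞) : WithTop ℕ∞) f₀ ∧ Set.InjOn f₀ (Metric.closedBall (0 : EuclideanSpace ℝ (Fin 2)) 1) ∧ (∀ x ∈ Metric.closedBall (0 : EuclideanSpace ℝ (Fin 2)) 1, Function.Injective (mfderiv (𝓡 2) (𝓡 4) f₀ x)) ∧ (∀ x : EuclideanSpace ℝ (Fin 2), ‖x‖ < 1 → f₀ x ∉ i '' Literature.Topology.FourManifolds.MMSW.modelHandlebody k) ∧ (∀ t : (Metric.sphere (0 : EuclideanSpace ℝ (Fin 2)) 1), f₀ t = i (K₀ t)) ∧ ContDiff ℝ ((⊤ : ℕ∞) : WithTop ℕ∞) g₀ ∧ (∃ η : ℝ, 0 < η ∧ (∀ x : EuclideanSpace ℝ (Fin 2), 1 - η < ‖x‖ → ‖x‖ ≤ 1 → g₀ x ∈ U ∧ f₀ x = i (g₀ x))) ∧ (∀ t : (Metric.sphere (0 : EuclideanSpace ℝ (Fin 2)) 1), deriv (fun ρ : ℝ => Literature.Topology.FourManifolds.MMSW.levelFun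 k (g₀ (ρ • (t : EuclideanSpace ℝ (Fin 2))))) 1 < 0)) ∧ (((E : Set (EuclideanSpace ℝ (Fin 4))) = {x | x ∉ Literature.Topology.FourManifolds.MMSW.modelHandlebody k ∧ x ∉ f₁ '' Metric.closedBall (0 : EuclideanSpace ℝ (Fin 2)) 1}) ∧ Manifold.IsSmoothEmbedding (𝓡 4) (𝓡 4) ((⊤ : ℕ∞) : WithTop ℕ∞) j ∧ IsOpen (Set.range j) ∧ Set.range j = (i '' Literature.Topology.FourManifolds.MMSW.modelHandlebody k ∪ f₀ '' Metric.closedBall (0 : EuclideanSpace ℝ (Fin 2)) 1 ∪ {q})ᶜ ∧ (∀ s ∈ nhds q, ∃ R : ℝ, ∀ a : E, R < ‖(a : EuclideanSpace ℝ (Fin 4))‖ → j a ∈ s)) ∧ (∀ v : (Metric.sphere (0 : EuclideanSpace ℝ (Fin 2)) 1), m v = T ((0 : EuclideanSpace ℝ (Fin 2)), (1 / 2 : ℝ) • (v : EuclideanSpace ℝ (Fin 2)))) ∧ (∀ (v : (Metric.sphere (0 : EuclideanSpace ℝ (Fin 2)) 1)) (a : E), (a : EuclideanSpace ℝ (Fin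 4)) = m v → ℓ v = j a) ∧ (∃ x₀ : X, (c.comp μ₀).Homotopic (ContinuousMap.const (Metric.sphere (0 : EuclideanSpace ℝ (Fin 2)) 1) x₀)) ∧ ((∃ x₀ : X, (c.comp μ₁).Homotopic (ContinuousMap.const (Metric.sphere (0 : EuclideanSpace ℝ (Fin 2)) 1) x₀)) → ∃ x₀ : X, ℓ.Homotopic (ContinuousMap.const (Metric.sphere (0 : EuclideanSpace ℝ (Fin 2)) 1) x₀)) := by
  intro hP hT hV k K₀ K₁ f₁ T hK₀ hw₀ hK₁ hN₁ hw₁ hf₁ hneat hTube L₀ L₁ hL₀ hL₁ Y _ _ _ _ _ jA₀ jB₀ jA₁ jB₁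
    μ₀ μ₁ hP₀ hP₁ hμ₀ hμ₁
  -- Step 0: re-present `Y` as surgery on the model boundary along `K₀` and along `K₁` (P_k, twice)
  obtain ⟨jBl₀, νK₀, jM₀, W₀, ψ₀, ν'₀, r₀, hM₀, hcore₀, -⟩ := hP k K₀ hK₀ hw₀ L₀ hL₀ Y jA₀ jB₀ hP₀
  obtain ⟨jBl₁, νK₁, jM₁, W₁, ψ₁, ν'₁, r₁, hM₁, hcore₁, hfr₁⟩ := hP k K₁ hK₁ hw₁ L₁ hL₁ Y jA₁ jB₁ hP₁
  have hμ₀' : ∀ (v : Metric.sphere (0 : EuclideanSpace ℝ (Fin 2)) 1) (b : solidTorus),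
      (b : EuclideanSpace ℝ (Fin 2) × Metric.sphere (0 : EuclideanSpace ℝ (Fin 2)) 1) =
        ((0 : EuclideanSpace ℝ (Fin 2)), v) → μ₀ v = jBl₀ b := fun v b hb => by
    rw [hμ₀ v b hb, hcore₀ b (by rw [hb])]
  have hμ₁' : ∀ (v : Metric.sphere (0 : EuclideanSpace ℝ (Fin 2)) 1) (b : solidTorus),
      (b : EuclideanSpace ℝ (Fin 2) × Metric.sphere (0 : EuclideanSpace ℝ (Fin 2)) 1) =
        ((0 : EuclideanSpace ℝ (Fin 2)), v) → μ₁ v = jBl₁ b := fun v b hb => by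
    rw [hμ₁ v b hb, hcore₁ b (by rw [hb])]
  -- Step 1: the trace side (T_k)
  obtain ⟨TT, _, _, _, _, U, iT, fT, g₀, cT, hGerm, hDisc, hsT, hcT, hcT', htT, hKT, hclT, hnull⟩ :=
    hT k K₀ hK₀ Y jBl₀ μ₀ νK₀ jM₀ W₀ ψ₀ hM₀ hμ₀'
  -- Step 2: the exterior side (V_k) on the inverted model disc exterior `F = E^`
  obtain ⟨-, hEo, hFo⟩ := helper_friendsCarrier_exterior k K₁ f₁ hf₁
  set E : TopologicalSpace.Opens (EuclideanSpace ℝ (Fin 4)) := ⟨_, hEo⟩ with hEdef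
  set F : TopologicalSpace.Opens (EuclideanSpace ℝ (Fin 4)) := ⟨_, hFo⟩ with hFdef
  obtain ⟨h0F, hEne, ι, hιval, hιemb, hιopen, hιrange, hιlim⟩ :=
    helper_friendsCarrier_inversion k K₁ f₁ hf₁ E F rfl rfl
  obtain ⟨cV, hsV, hcV, hcV', hclV, hKV, hhom⟩ := hV k K₁ f₁ T hK₁ hN₁ hw₁ hf₁ hneat hTube Y jBl₁ μ₁ νK₁
    jM₁ W₁ ψ₁ hM₁ hμ₁' (L₁.component (Fin.last k)) ν'₁ r₁ hfr₁ E F rfl rfl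
  -- Step 3: glue along the two collars
  let d : SmoothGlueData (𝓡 4) (𝓡 4) TT F (EuclideanSpace ℝ (Fin 4)) :=
    SmoothGlueData.ofCollars cT cV hsT hsV hcT hcT' hcV hcV' (ContinuousLinearEquiv.refl ℝ _)
      (ContinuousLinearEquiv.refl ℝ _)
  -- the compact core of the trace side
  set C : Set TT := iT '' modelHandlebody k ∪ fT '' Metric.closedBall (0 : EuclideanSpace ℝ (Fin 2)) 1
    with hC
  have hCt : cT.targetᶜ = C := by rw [htT, compl_compl]
  haveI : T2Space d.Glued :=
    SmoothGlueData.t2Space_ofCollars (s := fun p : Y × ℝ => p.2) continuous_snd hclT hclV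
  haveI : CompactSpace d.Glued := by
    refine SmoothGlueData.compactSpace_ofCollars (fun p : Y × ℝ => p.2) ?_ (hKV 0)
    rw [hCt]
    exact hKT 0
  haveI : SecondCountableTopology d.Glued := d.secondCountableTopology
  -- the differentials of `inl` is injective (it is an immersion)
  have himmL : ∀ x, Injective (mfderiv (𝓡 4) (𝓡 4) d.inl x) := by
    obtain ⟨F', _, _, hF'⟩ := d.isSmoothEmbedding_inl.isImmersion
    exact fun x => Manifold.IsImmersionAtOfComplement.mfderiv_injective (hF' x) (by simp)
  have hn : (∞ : ℕ∞ω) ≠ 0 := by simp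
  -- Step 4: the tube meridian `m v = T(0, v/2)` lies in the model disc exterior `E`
  have hmE : ∀ v : Metric.sphere (0 : EuclideanSpace ℝ (Fin 2)) 1,
      T ((0 : EuclideanSpace ℝ (Fin 2)), (1 / 2 : ℝ) • (v : EuclideanSpace ℝ (Fin 2))) ∈
        (E : Set (EuclideanSpace ℝ (Fin 4))) :=
    helper_friendsCarrier_tubeMeridian k K₁ f₁ T hK₁ hf₁ hTube
  obtain ⟨hTs, -, -, -, -⟩ := hTube
  set m : Metric.sphere (0 : EuclideanSpace ℝ (Fin 2)) 1 → EuclideanSpace ℝ (Fin 4) :=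
    fun v => T ((0 : EuclideanSpace ℝ (Fin 2)), (1 / 2 : ℝ) • (v : EuclideanSpace ℝ (Fin 2))) with hm
  have hq2 : ∀ v : Metric.sphere (0 : EuclideanSpace ℝ (Fin 2)) 1,
      ((0 : EuclideanSpace ℝ (Fin 2)), (1 / 2 : ℝ) • (v : EuclideanSpace ℝ (Fin 2))) ∈
        Metric.ball (0 : EuclideanSpace ℝ (Fin 2)) 1 ×ˢ Metric.ball (0 : EuclideanSpace ℝ (Fin 2)) 2 := by
    intro v
    refine ⟨by simp, ?_⟩
    rw [mem_ball_zero_iff, norm_smul, norm_eq_of_mem_sphere v]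
    norm_num
  have hmc : Continuous m :=
    hTs.continuousOn.comp_continuous (by fun_prop) hq2
  -- the point at infinity, the pushed meridian, the collar map
  set z₀ : F := ⟨0, h0F⟩ with hz₀
  have hιc : Continuous ι := hιemb.contMDiff.continuous
  let ℓ : C(Metric.sphere (0 : EuclideanSpace ℝ (Fin 2)) 1, d.Glued) :=
    ⟨fun v => d.inr (ι ⟨m v, hmE v⟩), d.continuous_inr.comp (hιc.comp (hmc.subtype_mk hmE))⟩
  have hcTc : Continuous cT := continuousOn_univ.1 (hsT ▸ cT.continuousOn)
  have hcVc : Continuous cV := continuousOn_univ.1 (hsV ▸ cV.continuousOn)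
  let cmap : C(Y, d.Glued) :=
    ⟨fun y => d.inl (cT (y, 0)), d.continuous_inl.comp (hcTc.comp (continuous_id.prodMk continuous_const))⟩
  let inlC : C(TT, d.Glued) := ⟨d.inl, d.continuous_inl⟩
  let inrC : C(F, d.Glued) := ⟨d.inr, d.continuous_inr⟩
  -- the range of `inr`
  have hrange : range d.inr = (d.inl '' C)ᶜ := by
    rw [SmoothGlueData.range_inr_ofCollars, hCt]
  obtain ⟨hUo, hDU, hiU, hinjU, himmU⟩ := hGerm
  obtain ⟨hfs, hfinj, hfimm, hfout, hfbd, hg₀, hη, hsign⟩ := hDisc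
  refine ⟨d.Glued, inferInstance, inferInstance, inferInstance, inferInstance, inferInstance,
    inferInstance, U, d.inl ∘ iT, d.inl ∘ fT, g₀, E, d.inr ∘ ι, d.inr z₀, cmap, m, ℓ,
    ⟨hUo, hDU, d.contMDiff_inl.comp_contMDiffOn hiU, d.inl_injective.comp_injOn hinjU, fun x hx => ?_⟩,
    ⟨d.contMDiff_inl.comp hfs, d.inl_injective.comp_injOn hfinj, fun x hx => ?_, ?_, fun t => ?_, hg₀, ?_,
      hsign⟩,
    ⟨rfl, d.isSmoothEmbedding_inr_comp hιemb, ?_, ?_, ?_⟩, fun v => rfl, ?_, ?_, ?_⟩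
  · -- germ chart: injective differential
    rw [mfderiv_comp x (d.contMDiff_inl.mdifferentiableAt hn)
      ((hiU.contMDiffAt (hUo.mem_nhds hx)).mdifferentiableAt hn)]
    exact (himmL _).comp (himmU x hx)
  · -- core disc: injective differential
    rw [mfderiv_comp x (d.contMDiff_inl.mdifferentiableAt hn) (hfs.mdifferentiableAt hn)]
    exact (himmL _).comp (hfimm x hx)
  · -- the open core disc misses `i(D_k)`
    rintro x hx ⟨y, hy, hxy⟩
    exact hfout x hx ⟨y, hy, d.inl_injective hxy⟩
  · -- boundary
    show d.inl (fT t) = d.inl (iT (K₀ t))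
    rw [hfbd t]
  · -- the collar band of the core disc
    obtain ⟨η, hη0, hηP⟩ := hη
    exact ⟨η, hη0, fun x h1 h2 => ⟨(hηP x h1 h2).1, by
      show d.inl (fT x) = d.inl (iT (g₀ x)); rw [(hηP x h1 h2).2]⟩⟩
  · -- `range j` is open
    rw [range_comp]
    exact d.isOpenMap_inr _ hιopen
  · -- `range j` is the complement of the core and the point at infinity
    rw [range_comp, hιrange]
    have hcore : (d.inl ∘ iT) '' modelHandlebody k ∪ (d.inl ∘ fT) '' Metric.closedBall (0 : EuclideanSpace ℝ (Fin 2)) 1 =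
        d.inl '' C := by
      rw [hC, image_union, image_comp, image_comp]
    rw [hcore, ← compl_inj_iff, compl_compl]
    ext p
    simp only [mem_union, mem_singleton_iff, mem_compl_iff, mem_image, mem_setOf_eq]
    constructor
    · intro hp
      by_cases hpr : p ∈ range d.inr
      · obtain ⟨z, rfl⟩ := hpr
        right
        by_contra hne
        exact hp ⟨z, fun h0 => hne (by rw [show z = z₀ from Subtype.ext h0]), rfl⟩
      · left
        rw [hrange, mem_compl_iff, not_not] at hpr
        exact hpr
    · rintro (hp | rfl)
      · rintro ⟨z, hz, rfl⟩
        exact (hrange.le ⟨z, rfl⟩) hp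
      · rintro ⟨z, hz, hzq⟩
        exact hz (by rw [d.inr_injective hzq])
  · -- `j a → q` as `‖a‖ → ∞`
    intro s hs
    have hs' : d.inr ⁻¹' s ∈ 𝓝 z₀ := d.continuous_inr.continuousAt.preimage_mem_nhds hs
    obtain ⟨R, hR⟩ := hιlim z₀ rfl _ hs'
    exact ⟨R, fun a ha => hR a ha⟩
  · -- the pushed meridian is `j ∘ m`
    intro v a ha
    show d.inr (ι ⟨m v, hmE v⟩) = d.inr (ι a)
    rw [show (⟨m v, hmE v⟩ : E) = a from Subtype.ext ha.symm]
  · -- (6a): the dual knot of `K₀` bounds the cocore of the 2-handle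
    let L₀ : C(Metric.sphere (0 : EuclideanSpace ℝ (Fin 2)) 1, TT) :=
      ⟨fun v => cT (μ₀ v, 0), hcTc.comp (μ₀.continuous.prodMk continuous_const)⟩
    obtain ⟨x₀, hx₀⟩ := hnull L₀ fun v => rfl
    refine ⟨d.inl x₀, ?_⟩
    have h1 : (inlC.comp L₀).Homotopic (inlC.comp (ContinuousMap.const _ x₀)) :=
      (ContinuousMap.Homotopic.refl inlC).comp hx₀
    have h2 : cmap.comp μ₀ = inlC.comp L₀ := by ext v; rfl
    have h3 : inlC.comp (ContinuousMap.const (Metric.sphere (0 : EuclideanSpace ℝ (Fin 2)) 1) x₀) =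
        ContinuousMap.const _ (d.inl x₀) := by ext v; rfl
    rw [h2, ← h3]
    exact h1
  · -- (6b): across the neck the dual knot of `K₁` is the exterior collar's loop; push null-homotopies
    rintro ⟨x₀, hx₀⟩
    let L₁ : C(Metric.sphere (0 : EuclideanSpace ℝ (Fin 2)) 1, F) :=
      ⟨fun v => cV (μ₁ v, 0), hcVc.comp (μ₁.continuous.prodMk continuous_const)⟩
    let L₂ : C(Metric.sphere (0 : EuclideanSpace ℝ (Fin 2)) 1, F) :=
      ⟨fun v => ι ⟨m v, hmE v⟩, hιc.comp (hmc.subtype_mk hmE)⟩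
    have hkey : cmap.comp μ₁ = inrC.comp L₁ := by
      ext v
      show d.inl (cT (μ₁ v, 0)) = d.inr (cV (μ₁ v, 0))
      exact SmoothGlueData.inl_collar_eq_inr_collar (μ₁ v, 0)
    have hL₂ : ∀ v : Metric.sphere (0 : EuclideanSpace ℝ (Fin 2)) 1,
        ((L₂ v : F) : EuclideanSpace ℝ (Fin 4)) = (‖m v‖ ^ 2)⁻¹ • m v := fun v => hιval ⟨m v, hmE v⟩
    obtain ⟨z, hz⟩ := hhom L₁ L₂ (fun v => rfl) hL₂ d.Glued inrC ⟨x₀, hkey ▸ hx₀⟩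
    exact ⟨z, hz⟩

/-- **Stub `stub_friendsCarrier` (A, the carrier; skeleton v3) CLOSED MODULO `P_k`, `T_k`, `V_k`.**
The conclusion is the registered stub verbatim; the hypotheses are the named literature fact
`pictureSurgeryPresentation` (`hP`, Kirby's Lemma 2.1 in the MMSW picture) and the two open registered
helper stubs `helper_friendsCarrier_Tk` (`hT`, relative open trace) and `helper_friendsCarrier_Vk`
(`hV`, collared end of the inverted disc exterior), by `helper_friendsCarrier_of_collars`.
[cite: ManolescuPiccirillo2023, §3.2, proof of Lemma 3.3] -/
theorem stub_friendsCarrier_of_collars (hP : Literature.Topology.FourManifolds.pictureSurgeryPresentation) (hT : ∀ (k : ℕ) (K₀ : (Metric.sphere (0 : EuclideanSpace ℝ (Fin 2)) 1) → EuclideanSpace ℝ (Fin 4)), Literature.Topology.FourManifolds.MMSW.IsModelKnot k K₀ → ∀ (Y : Type) [TopologicalSpace Y] [T2Space Y] [SecondCountableTopology Y] [ChartedSpace (EuclideanSpace ℝ (Fin 3)) Y] [IsManifold (𝓡 3) ((⊤ : ℕ∞) : WithTop ℕ∞) Y] (jB : Literature.Topology.FourManifolds.solidTorus → Y) (μ₀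 : C((Metric.sphere (0 : EuclideanSpace ℝ (Fin 2)) 1), Y)) (νK : (Metric.sphere (0 : EuclideanSpace ℝ (Fin 2)) 1) × EuclideanSpace ℝ (Fin 2) → EuclideanSpace ℝ (Fin 4)) (jM : EuclideanSpace ℝ (Fin 4) → Y) (W : Set (EuclideanSpace ℝ (Fin 4))) (ψ : Y → EuclideanSpace ℝ (Fin 4)), (Manifold.IsSmoothEmbedding (𝓘(ℝ, EuclideanSpace ℝ (Fin 2)).prod (𝓡 1)) (𝓡 3) ((⊤ : ℕ∞) : WithTop ℕ∞) jB ∧ IsOpen (Set.range jB) ∧ ContMDiff ((𝓡 1).prod 𝓘(ℝ, EuclideanSpace ℝ (Fin 2))) 𝓘(ℝ, EuclideanSpace ℝ (Fin 4)) ((⊤ : ℕ∞) : WithTop ℕ∞) νK ∧ Function.Injective νK ∧ (∀ p, Function.Injective (mfderiv ((𝓡 1).prod 𝓘(ℝ, EuclideanSpace ℝ (Fin 2))) 𝓘(ℝ, EuclideanSpace ℝ (Fin 4)) νK p)) ∧ (∀ p, νK p ∈ Literature.Topology.FourManifolds.MMSW.modelBoundary k) ∧ (∀ u : (Metric.sphere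 (0 : EuclideanSpace ℝ (Fin 2)) 1), νK (u, 0) = K₀ u) ∧ IsOpen W ∧ (∀ x ∈ Literature.Topology.FourManifolds.MMSW.modelBoundary k, x ∉ Set.range K₀ → x ∈ W) ∧ ContMDiffOn 𝓘(ℝ, EuclideanSpace ℝ (Fin 4)) (𝓡 3) ((⊤ : ℕ∞) : WithTop ℕ∞) jM W ∧ IsOpen (jM '' {x : EuclideanSpace ℝ (Fin 4) | x ∈ Literature.Topology.FourManifolds.MMSW.modelBoundary k ∧ x ∉ Set.range K₀}) ∧ ContMDiffOn (𝓡 3) 𝓘(ℝ, EuclideanSpace ℝ (Fin 4)) ((⊤ : ℕ∞) : WithTop ℕ∞) ψ (jM '' {x : EuclideanSpace ℝ (Fin 4) | x ∈ Literature.Topology.FourManifolds.MMSW.modelBoundary k ∧ x ∉ Set.range K₀}) ∧ (∀ x ∈ Literature.Topology.FourManifolds.MMSW.modelBoundary k, x ∉ Set.range K₀ → ψ (jM x) = x) ∧ jM '' {x : EuclideanSpace ℝ (Fin 4) | x ∈ Literature.Topology.FourManifolds.MMSW.modelBoundary k ∧ x ∉ Set.range K₀} ∪ Set.range jB = Set.univ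 ∧ (∀ x ∈ Literature.Topology.FourManifolds.MMSW.modelBoundary k, x ∉ Set.range K₀ → ∀ b : Literature.Topology.FourManifolds.solidTorus, jM x = jB b ↔ ∃ (u : (Metric.sphere (0 : EuclideanSpace ℝ (Fin 2)) 1)) (t : ℝ), t ∈ Set.Ioo (0 : ℝ) 1 ∧ (b : EuclideanSpace ℝ (Fin 2) × (Metric.sphere (0 : EuclideanSpace ℝ (Fin 2)) 1)).1 = t • (u : EuclideanSpace ℝ (Fin 2)) ∧ x = νK (u, t • ((b : EuclideanSpace ℝ (Fin 2) × (Metric.sphere (0 : EuclideanSpace ℝ (Fin 2)) 1)).2 : EuclideanSpace ℝ (Fin 2))))) → (∀ (v : (Metric.sphere (0 : EuclideanSpace ℝ (Fin 2)) 1)) (b : Literature.Topology.FourManifolds.solidTorus), (b : EuclideanSpace ℝ (Fin 2) × (Metric.sphere (0 : EuclideanSpace ℝ (Fin 2)) 1)) = ((0 : EuclideanSpace ℝ (Fin 2)), v) → μ₀ v = jB b) → ∃ (X : Type) (_ : TopologicalSpace X) (_ : T2Space X) (_ : ChartedSpace (EuclideanSpace ℝ (Fin 4)) X) (_ : IsManifold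 (𝓡 4) ((⊤ : ℕ∞) : WithTop ℕ∞) X) (U : Set (EuclideanSpace ℝ (Fin 4))) (i : EuclideanSpace ℝ (Fin 4) → X) (f₀ : EuclideanSpace ℝ (Fin 2) → X) (g₀ : EuclideanSpace ℝ (Fin 2) → EuclideanSpace ℝ (Fin 4)) (c : OpenPartialHomeomorph (Y × ℝ) X), (IsOpen U ∧ Literature.Topology.FourManifolds.MMSW.modelHandlebody k ⊆ U ∧ ContMDiffOn (𝓡 4) (𝓡 4) ((⊤ : ℕ∞) : WithTop ℕ∞) i U ∧ Set.InjOn i U ∧ (∀ x ∈ U, Function.Injective (mfderiv (𝓡 4) (𝓡 4) i x))) ∧ (ContMDiff (𝓡 2) (𝓡 4) ((⊤ : ℕ∞) : WithTop ℕ∞) f₀ ∧ Set.InjOn f₀ (Metric.closedBall (0 : EuclideanSpace ℝ (Fin 2)) 1) ∧ (∀ x ∈ Metric.closedBall (0 : EuclideanSpace ℝ (Fin 2)) 1, Function.Injective (mfderiv (𝓡 2) (𝓡 4) f₀ x)) ∧ (∀ x : EuclideanSpace ℝ (Fin 2), ‖x‖ < 1 → f₀ x ∉ i '' Literature.Topology.FourManifolds.MMSW.modelHandlebody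 k) ∧ (∀ t : (Metric.sphere (0 : EuclideanSpace ℝ (Fin 2)) 1), f₀ t = i (K₀ t)) ∧ ContDiff ℝ ((⊤ : ℕ∞) : WithTop ℕ∞) g₀ ∧ (∃ η : ℝ, 0 < η ∧ (∀ x : EuclideanSpace ℝ (Fin 2), 1 - η < ‖x‖ → ‖x‖ ≤ 1 → g₀ x ∈ U ∧ f₀ x = i (g₀ x))) ∧ (∀ t : (Metric.sphere (0 : EuclideanSpace ℝ (Fin 2)) 1), deriv (fun ρ : ℝ => Literature.Topology.FourManifolds.MMSW.levelFun k (g₀ (ρ • (t : EuclideanSpace ℝ (Fin 2))))) 1 < 0)) ∧ c.source = Set.univ ∧ ContMDiffOn ((𝓡 3).prod 𝓘(ℝ, ℝ)) (𝓡 4) ((⊤ : ℕ∞) : WithTop ℕ∞) c c.source ∧ ContMDiffOn (𝓡 4) ((𝓡 3).prod 𝓘(ℝ, ℝ)) ((⊤ : ℕ∞) : WithTop ℕ∞) c.symm c.target ∧ c.target = (i '' Literature.Topology.FourManifolds.MMSW.modelHandlebody k ∪ f₀ '' Metric.closedBall (0 : EuclideanSpace ℝ (Fin 2)) 1)ᶜ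 ∧ (∀ a : ℝ, IsCompact ((i '' Literature.Topology.FourManifolds.MMSW.modelHandlebody k ∪ f₀ '' Metric.closedBall (0 : EuclideanSpace ℝ (Fin 2)) 1) ∪ c '' {p | p.2 ≤ a})) ∧ (∀ a : ℝ, IsClosed (c '' {p | a ≤ p.2})) ∧ ∀ L₀ : C((Metric.sphere (0 : EuclideanSpace ℝ (Fin 2)) 1), X), (∀ v, L₀ v = c (μ₀ v, 0)) → ∃ x₀ : X, L₀.Homotopic (ContinuousMap.const (Metric.sphere (0 : EuclideanSpace ℝ (Fin 2)) 1) x₀)) (hV : ∀ (k : ℕ) (K₁ : (Metric.sphere (0 : EuclideanSpace ℝ (Fin 2)) 1) → EuclideanSpace ℝ (Fin 4)) (f₁ : EuclideanSpace ℝ (Fin 2) → EuclideanSpace ℝ (Fin 4)) (T : EuclideanSpace ℝ (Fin 2) × EuclideanSpace ℝ (Fin 2) → EuclideanSpace ℝ (Fin 4)), Literature.Topology.FourManifolds.MMSW.IsModelKnot k K₁ → Literature.Topology.FourManifolds.MMSW.IsNullHomologous k K₁ → (∀ t, Literature.AlgebraicTopology.Homotopy.HopfFibration.wC (K₁ t)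 ≠ 0) → Literature.Topology.FourManifolds.MMSW.IsModelSliceDisc k K₁ f₁ → (∀ t : (Metric.sphere (0 : EuclideanSpace ℝ (Fin 2)) 1), deriv (fun ρ : ℝ => Literature.Topology.FourManifolds.MMSW.levelFun k (f₁ (ρ • (t : EuclideanSpace ℝ (Fin 2))))) 1 < 0) → (ContDiffOn ℝ ((⊤ : ℕ∞) : WithTop ℕ∞) T (Metric.ball (0 : EuclideanSpace ℝ (Fin 2)) 1 ×ˢ Metric.ball (0 : EuclideanSpace ℝ (Fin 2)) 2) ∧ Set.InjOn T (Metric.ball (0 : EuclideanSpace ℝ (Fin 2)) 1 ×ˢ Metric.ball (0 : EuclideanSpace ℝ (Fin 2)) 2) ∧ (∀ q ∈ Metric.ball (0 : EuclideanSpace ℝ (Fin 2)) 1 ×ˢ Metric.ball (0 : EuclideanSpace ℝ (Fin 2)) 2, Function.Injective (fderiv ℝ T q)) ∧ (∀ q ∈ Metric.ball (0 : EuclideanSpace ℝ (Fin 2)) 1 ×ˢ Metric.ball (0 : EuclideanSpace ℝ (Fin 2)) 2, T q ∉ Literature.Topology.FourManifolds.MMSW.modelHandlebody k) ∧ (∀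 x ∈ Metric.ball (0 : EuclideanSpace ℝ (Fin 2)) 1, T (x, 0) = f₁ x)) → ∀ (Y : Type) [TopologicalSpace Y] [T2Space Y] [SecondCountableTopology Y] [ChartedSpace (EuclideanSpace ℝ (Fin 3)) Y] [IsManifold (𝓡 3) ((⊤ : ℕ∞) : WithTop ℕ∞) Y] (jB : Literature.Topology.FourManifolds.solidTorus → Y) (μ₁ : C((Metric.sphere (0 : EuclideanSpace ℝ (Fin 2)) 1), Y)) (νK : (Metric.sphere (0 : EuclideanSpace ℝ (Fin 2)) 1) × EuclideanSpace ℝ (Fin 2) → EuclideanSpace ℝ (Fin 4)) (jM : EuclideanSpace ℝ (Fin 4) → Y) (W : Set (EuclideanSpace ℝ (Fin 4))) (ψ : Y → EuclideanSpace ℝ (Fin 4)), (Manifold.IsSmoothEmbedding (𝓘(ℝ, EuclideanSpace ℝ (Fin 2)).prod (𝓡 1)) (𝓡 3) ((⊤ : ℕ∞) : WithTop ℕ∞) jB ∧ IsOpen (Set.range jB) ∧ ContMDiff ((𝓡 1).prod 𝓘(ℝ, EuclideanSpace ℝ (Fin 2))) 𝓘(ℝ, EuclideanSpace ℝ (Fin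 4)) ((⊤ : ℕ∞) : WithTop ℕ∞) νK ∧ Function.Injective νK ∧ (∀ p, Function.Injective (mfderiv ((𝓡 1).prod 𝓘(ℝ, EuclideanSpace ℝ (Fin 2))) 𝓘(ℝ, EuclideanSpace ℝ (Fin 4)) νK p)) ∧ (∀ p, νK p ∈ Literature.Topology.FourManifolds.MMSW.modelBoundary k) ∧ (∀ u : (Metric.sphere (0 : EuclideanSpace ℝ (Fin 2)) 1), νK (u, 0) = K₁ u) ∧ IsOpen W ∧ (∀ x ∈ Literature.Topology.FourManifolds.MMSW.modelBoundary k, x ∉ Set.range K₁ → x ∈ W) ∧ ContMDiffOn 𝓘(ℝ, EuclideanSpace ℝ (Fin 4)) (𝓡 3) ((⊤ : ℕ∞) : WithTop ℕ∞) jM W ∧ IsOpen (jM '' {x : EuclideanSpace ℝ (Fin 4) | x ∈ Literature.Topology.FourManifolds.MMSW.modelBoundary k ∧ x ∉ Set.range K₁}) ∧ ContMDiffOn (𝓡 3) 𝓘(ℝ, EuclideanSpace ℝ (Fin 4)) ((⊤ : ℕ∞) : WithTop ℕ∞) ψ (jM '' {x : EuclideanSpace ℝ (Fin 4) | x ∈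 Literature.Topology.FourManifolds.MMSW.modelBoundary k ∧ x ∉ Set.range K₁}) ∧ (∀ x ∈ Literature.Topology.FourManifolds.MMSW.modelBoundary k, x ∉ Set.range K₁ → ψ (jM x) = x) ∧ jM '' {x : EuclideanSpace ℝ (Fin 4) | x ∈ Literature.Topology.FourManifolds.MMSW.modelBoundary k ∧ x ∉ Set.range K₁} ∪ Set.range jB = Set.univ ∧ (∀ x ∈ Literature.Topology.FourManifolds.MMSW.modelBoundary k, x ∉ Set.range K₁ → ∀ b : Literature.Topology.FourManifolds.solidTorus, jM x = jB b ↔ ∃ (u : (Metric.sphere (0 : EuclideanSpace ℝ (Fin 2)) 1)) (t : ℝ), t ∈ Set.Ioo (0 : ℝ) 1 ∧ (b : EuclideanSpace ℝ (Fin 2) × (Metric.sphere (0 : EuclideanSpace ℝ (Fin 2)) 1)).1 = t • (u : EuclideanSpace ℝ (Fin 2)) ∧ x = νK (u, t • ((b : EuclideanSpace ℝ (Fin 2) × (Metric.sphere (0 : EuclideanSpace ℝ (Fin 2)) 1)).2 : EuclideanSpace ℝ (Fin 2))))) → (∀ (v : (Metric.sphere (0 : EuclideanSpace ℝ (Fin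 2)) 1)) (b : Literature.Topology.FourManifolds.solidTorus), (b : EuclideanSpace ℝ (Fin 2) × (Metric.sphere (0 : EuclideanSpace ℝ (Fin 2)) 1)) = ((0 : EuclideanSpace ℝ (Fin 2)), v) → μ₁ v = jB b) → ∀ (J : Literature.Topology.FourManifolds.Knot) (ν' : Literature.Topology.FourManifolds.Knot.TubularNbhd J) (r : ℝ), (∀ p, Literature.AlgebraicTopology.Homotopy.HopfFibration.wC (νK p) ≠ 0) ∧ ν'.HasFraming 0 ∧ 0 < r ∧ (∀ (u : (Metric.sphere (0 : EuclideanSpace ℝ (Fin 2)) 1)) (w : EuclideanSpace ℝ (Fin 2)), ‖w‖ < 1 → Literature.Topology.FourManifolds.MMSW.toSphereThree (Literature.Topology.FourManifolds.MMSW.draw k (νK (u, w))).1 (Literature.Topology.FourManifolds.MMSW.draw k (νK (u, w))).2 = ν' (u, r • w)) → ∀ (E F : TopologicalSpace.Opens (EuclideanSpace ℝ (Fin 4))), (E : Set (EuclideanSpace ℝ (Fin 4))) = {x | x ∉ Literature.Topology.FourManifolds.MMSW.modelHandlebody k ∧ x ∉ f₁ '' Metric.closedBall (0 : EuclideanSpace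 ℝ (Fin 2)) 1} → (F : Set (EuclideanSpace ℝ (Fin 4))) = {0} ∪ {y : EuclideanSpace ℝ (Fin 4) | y ≠ 0 ∧ (‖y‖ ^ 2)⁻¹ • y ∉ Literature.Topology.FourManifolds.MMSW.modelHandlebody k ∧ (‖y‖ ^ 2)⁻¹ • y ∉ f₁ '' Metric.closedBall (0 : EuclideanSpace ℝ (Fin 2)) 1} → ∃ c : OpenPartialHomeomorph (Y × ℝ) F, c.source = Set.univ ∧ ContMDiffOn ((𝓡 3).prod 𝓘(ℝ, ℝ)) (𝓡 4) ((⊤ : ℕ∞) : WithTop ℕ∞) c c.source ∧ ContMDiffOn (𝓡 4) ((𝓡 3).prod 𝓘(ℝ, ℝ)) ((⊤ : ℕ∞) : WithTop ℕ∞) c.symm c.target ∧ (∀ a : ℝ, IsClosed (c '' {q | q.2 ≤ a})) ∧ (∀ a : ℝ, IsCompact (c.targetᶜ ∪ c '' {q | a ≤ q.2})) ∧ ∀ (L₁ L₂ : C((Metric.sphere (0 : EuclideanSpace ℝ (Fin 2)) 1), F)), (∀ v, L₁ v = c (μ₁ v, 0)) → (∀ v : (Metric.sphere (0 : EuclideanSpace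 ℝ (Fin 2)) 1), ((L₂ v : F) : EuclideanSpace ℝ (Fin 4)) = (‖T ((0 : EuclideanSpace ℝ (Fin 2)), (1 / 2 : ℝ) • (v : EuclideanSpace ℝ (Fin 2)))‖ ^ 2)⁻¹ • T ((0 : EuclideanSpace ℝ (Fin 2)), (1 / 2 : ℝ) • (v : EuclideanSpace ℝ (Fin 2)))) → ∀ (Z : Type) [TopologicalSpace Z] (g : C(F, Z)), (∃ z : Z, (g.comp L₁).Homotopic (ContinuousMap.const (Metric.sphere (0 : EuclideanSpace ℝ (Fin 2)) 1) z)) → ∃ z : Z, (g.comp L₂).Homotopic (ContinuousMap.const (Metric.sphere (0 : EuclideanSpace ℝ (Fin 2)) 1) z)) : ∀ (k : ℕ) (K₀ K₁ : (Metric.sphere (0 : EuclideanSpace ℝ (Fin 2)) 1) → EuclideanSpace ℝ (Fin 4)) (f₁ : EuclideanSpace ℝ (Fin 2) → EuclideanSpace ℝ (Fin 4)) (T : EuclideanSpace ℝ (Fin 2) × EuclideanSpace ℝ (Fin 2) → EuclideanSpace ℝ (Fin 4)), Literature.Topology.FourManifolds.MMSW.IsModelKnot k K₀ → (∀ t, Literature.AlgebraicTopology.Homotopy.HopfFibration.wC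 (K₀ t) ≠ 0) → Literature.Topology.FourManifolds.MMSW.IsModelKnot k K₁ → Literature.Topology.FourManifolds.MMSW.IsNullHomologous k K₁ → (∀ t, Literature.AlgebraicTopology.Homotopy.HopfFibration.wC (K₁ t) ≠ 0) → Literature.Topology.FourManifolds.MMSW.IsModelSliceDisc k K₁ f₁ → (∀ t : (Metric.sphere (0 : EuclideanSpace ℝ (Fin 2)) 1), deriv (fun ρ : ℝ => Literature.Topology.FourManifolds.MMSW.levelFun k (f₁ (ρ • (t : EuclideanSpace ℝ (Fin 2))))) 1 < 0) → (ContDiffOn ℝ ((⊤ : ℕ∞) : WithTop ℕ∞) T (Metric.ball (0 : EuclideanSpace ℝ (Fin 2)) 1 ×ˢ Metric.ball (0 : EuclideanSpace ℝ (Fin 2)) 2) ∧ Set.InjOn T (Metric.ball (0 : EuclideanSpace ℝ (Fin 2)) 1 ×ˢ Metric.ball (0 : EuclideanSpace ℝ (Fin 2)) 2) ∧ (∀ q ∈ Metric.ball (0 : EuclideanSpace ℝ (Fin 2)) 1 ×ˢ Metric.ball (0 : EuclideanSpace ℝ (Fin 2)) 2, Function.Injective (fderiv ℝ T q)) ∧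 (∀ q ∈ Metric.ball (0 : EuclideanSpace ℝ (Fin 2)) 1 ×ˢ Metric.ball (0 : EuclideanSpace ℝ (Fin 2)) 2, T q ∉ Literature.Topology.FourManifolds.MMSW.modelHandlebody k) ∧ (∀ x ∈ Metric.ball (0 : EuclideanSpace ℝ (Fin 2)) 1, T (x, 0) = f₁ x)) → ∀ (L₀ L₁ : Literature.Topology.FourManifolds.FramedLink (Fin (k + 1))), ((∀ j : Fin k, ⇑(L₀.component j.castSucc) = fun θ : (Metric.sphere (0 : EuclideanSpace ℝ (Fin 2)) 1) => Literature.Topology.FourManifolds.MMSW.toSphereThree ((4 * (((j : ℕ) : ℝ) + 1) + Literature.Topology.FourManifolds.MMSW.drawRadius k) * (θ : EuclideanSpace ℝ (Fin 2)) 0, (4 * (((j : ℕ) : ℝ) + 1) + Literature.Topology.FourManifolds.MMSW.drawRadius k) * (θ : EuclideanSpace ℝ (Fin 2)) 1) 0) ∧ ⇑(L₀.component (Fin.last k)) = Literature.Topology.FourManifolds.MMSW.finiteApprox k 0 K₀ ∧ (∀ i, L₀.framing i = 0)) → ((∀ j : Fin k, ⇑(L₁.component j.castSucc) = fun θ : (Metric.sphere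 (0 : EuclideanSpace ℝ (Fin 2)) 1) => Literature.Topology.FourManifolds.MMSW.toSphereThree ((4 * (((j : ℕ) : ℝ) + 1) + Literature.Topology.FourManifolds.MMSW.drawRadius k) * (θ : EuclideanSpace ℝ (Fin 2)) 0, (4 * (((j : ℕ) : ℝ) + 1) + Literature.Topology.FourManifolds.MMSW.drawRadius k) * (θ : EuclideanSpace ℝ (Fin 2)) 1) 0) ∧ ⇑(L₁.component (Fin.last k)) = Literature.Topology.FourManifolds.MMSW.finiteApprox k 0 K₁ ∧ (∀ i, L₁.framing i = 0)) → ∀ (Y : Type) [TopologicalSpace Y] [T2Space Y] [SecondCountableTopology Y] [ChartedSpace (EuclideanSpace ℝ (Fin 3)) Y] [IsManifold (𝓡 3) ((⊤ : ℕ∞) : WithTop ℕ∞) Y] (jA₀ : L₀.toLink.complement → Y) (jB₀ : Fin (k + 1) → Literature.Topology.FourManifolds.solidTorus → Y) (jA₁ : L₁.toLink.complement → Y) (jB₁ : Fin (k + 1) → Literature.Topology.FourManifolds.solidTorus → Y) (μ₀ μ₁ : C((Metric.sphere (0 : EuclideanSpace ℝ (Fin 2)) 1), Y)), (∃ ν :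 ∀ i, Literature.Topology.FourManifolds.Knot.TubularNbhd (L₀.component i), (∀ i, (ν i).HasFraming (L₀.framing i)) ∧ (Pairwise fun i i' => Disjoint (Set.range (ν i)) (Set.range (ν i'))) ∧ Manifold.IsSmoothEmbedding (𝓡 3) (𝓡 3) ((⊤ : ℕ∞) : WithTop ℕ∞) jA₀ ∧ IsOpen (Set.range jA₀) ∧ (∀ i, Manifold.IsSmoothEmbedding (𝓘(ℝ, EuclideanSpace ℝ (Fin 2)).prod (𝓡 1)) (𝓡 3) ((⊤ : ℕ∞) : WithTop ℕ∞) (jB₀ i) ∧ IsOpen (Set.range (jB₀ i))) ∧ Set.range jA₀ ∪ (⋃ i, Set.range (jB₀ i)) = Set.univ ∧ (Pairwise fun i i' => Disjoint (Set.range (jB₀ i)) (Set.range (jB₀ i'))) ∧ ∀ i a b, jA₀ a = jB₀ i b ↔ Literature.Topology.FourManifolds.Link.surgeryRel ν i a b) → (∃ ν : ∀ i, Literature.Topology.FourManifolds.Knot.TubularNbhd (L₁.component i), (∀ i, (ν i).HasFraming (L₁.framing i)) ∧ (Pairwise fun i i' => Disjoint (Set.range (ν i)) (Set.range (ν i')))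 ∧ Manifold.IsSmoothEmbedding (𝓡 3) (𝓡 3) ((⊤ : ℕ∞) : WithTop ℕ∞) jA₁ ∧ IsOpen (Set.range jA₁) ∧ (∀ i, Manifold.IsSmoothEmbedding (𝓘(ℝ, EuclideanSpace ℝ (Fin 2)).prod (𝓡 1)) (𝓡 3) ((⊤ : ℕ∞) : WithTop ℕ∞) (jB₁ i) ∧ IsOpen (Set.range (jB₁ i))) ∧ Set.range jA₁ ∪ (⋃ i, Set.range (jB₁ i)) = Set.univ ∧ (Pairwise fun i i' => Disjoint (Set.range (jB₁ i)) (Set.range (jB₁ i'))) ∧ ∀ i a b, jA₁ a = jB₁ i b ↔ Literature.Topology.FourManifolds.Link.surgeryRel ν i a b) → (∀ (v : (Metric.sphere (0 : EuclideanSpace ℝ (Fin 2)) 1)) (b : Literature.Topology.FourManifolds.solidTorus), (b : EuclideanSpace ℝ (Fin 2) × (Metric.sphere (0 : EuclideanSpace ℝ (Fin 2)) 1)) = ((0 : EuclideanSpace ℝ (Fin 2)), v) → μ₀ v = jB₀ (Fin.last k) b) → (∀ (v : (Metric.sphere (0 : EuclideanSpace ℝ (Fin 2)) 1)) (b : Literature.Topology.FourManifolds.solidTorus),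 (b : EuclideanSpace ℝ (Fin 2) × (Metric.sphere (0 : EuclideanSpace ℝ (Fin 2)) 1)) = ((0 : EuclideanSpace ℝ (Fin 2)), v) → μ₁ v = jB₁ (Fin.last k) b) → ∃ (X : Type) (_ : TopologicalSpace X) (_ : T2Space X) (_ : SecondCountableTopology X) (_ : ChartedSpace (EuclideanSpace ℝ (Fin 4)) X) (_ : IsManifold (𝓡 4) ((⊤ : ℕ∞) : WithTop ℕ∞) X) (_ : CompactSpace X) (U : Set (EuclideanSpace ℝ (Fin 4))) (i : EuclideanSpace ℝ (Fin 4) → X) (f₀ : EuclideanSpace ℝ (Fin 2) → X) (g₀ : EuclideanSpace ℝ (Fin 2) → EuclideanSpace ℝ (Fin 4)) (E : TopologicalSpace.Opens (EuclideanSpace ℝ (Fin 4))) (j : E → X) (q : X) (c : C(Y, X)) (m : (Metric.sphere (0 : EuclideanSpace ℝ (Fin 2)) 1) → EuclideanSpace ℝ (Fin 4)) (ℓ : C((Metric.sphere (0 : EuclideanSpace ℝ (Fin 2)) 1), X)), (IsOpen U ∧ Literature.Topology.FourManifolds.MMSW.modelHandlebody k ⊆ U ∧ ContMDiffOn (𝓡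 4) (𝓡 4) ((⊤ : ℕ∞) : WithTop ℕ∞) i U ∧ Set.InjOn i U ∧ (∀ x ∈ U, Function.Injective (mfderiv (𝓡 4) (𝓡 4) i x))) ∧ (ContMDiff (𝓡 2) (𝓡 4) ((⊤ : ℕ∞) : WithTop ℕ∞) f₀ ∧ Set.InjOn f₀ (Metric.closedBall (0 : EuclideanSpace ℝ (Fin 2)) 1) ∧ (∀ x ∈ Metric.closedBall (0 : EuclideanSpace ℝ (Fin 2)) 1, Function.Injective (mfderiv (𝓡 2) (𝓡 4) f₀ x)) ∧ (∀ x : EuclideanSpace ℝ (Fin 2), ‖x‖ < 1 → f₀ x ∉ i '' Literature.Topology.FourManifolds.MMSW.modelHandlebody k) ∧ (∀ t : (Metric.sphere (0 : EuclideanSpace ℝ (Fin 2)) 1), f₀ t = i (K₀ t)) ∧ ContDiff ℝ ((⊤ : ℕ∞) : WithTop ℕ∞) g₀ ∧ (∃ η : ℝ, 0 < η ∧ (∀ x : EuclideanSpace ℝ (Fin 2), 1 - η < ‖x‖ → ‖x‖ ≤ 1 → g₀ x ∈ U ∧ f₀ x = i (g₀ x))) ∧ (∀ t : (Metric.sphere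 (0 : EuclideanSpace ℝ (Fin 2)) 1), deriv (fun ρ : ℝ => Literature.Topology.FourManifolds.MMSW.levelFun k (g₀ (ρ • (t : EuclideanSpace ℝ (Fin 2))))) 1 < 0)) ∧ (((E : Set (EuclideanSpace ℝ (Fin 4))) = {x | x ∉ Literature.Topology.FourManifolds.MMSW.modelHandlebody k ∧ x ∉ f₁ '' Metric.closedBall (0 : EuclideanSpace ℝ (Fin 2)) 1}) ∧ Manifold.IsSmoothEmbedding (𝓡 4) (𝓡 4) ((⊤ : ℕ∞) : WithTop ℕ∞) j ∧ IsOpen (Set.range j) ∧ Set.range j = (i '' Literature.Topology.FourManifolds.MMSW.modelHandlebody k ∪ f₀ '' Metric.closedBall (0 : EuclideanSpace ℝ (Fin 2)) 1 ∪ {q})ᶜ ∧ (∀ s ∈ nhds q, ∃ R : ℝ, ∀ a : E, R < ‖(a : EuclideanSpace ℝ (Fin 4))‖ → j a ∈ s)) ∧ (∀ v : (Metric.sphere (0 : EuclideanSpace ℝ (Fin 2)) 1), m v = T ((0 : EuclideanSpace ℝ (Fin 2)), (1 / 2 : ℝ) • (v : EuclideanSpace ℝ (Fin 2)))) ∧ (∀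 (v : (Metric.sphere (0 : EuclideanSpace ℝ (Fin 2)) 1)) (a : E), (a : EuclideanSpace ℝ (Fin 4)) = m v → ℓ v = j a) ∧ (∃ x₀ : X, (c.comp μ₀).Homotopic (ContinuousMap.const (Metric.sphere (0 : EuclideanSpace ℝ (Fin 2)) 1) x₀)) ∧ ((∃ x₀ : X, (c.comp μ₁).Homotopic (ContinuousMap.const (Metric.sphere (0 : EuclideanSpace ℝ (Fin 2)) 1) x₀)) → ∃ x₀ : X, ℓ.Homotopic (ContinuousMap.const (Metric.sphere (0 : EuclideanSpace ℝ (Fin 2)) 1) x₀)) :=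
  helper_friendsCarrier_of_collars hP hT hV

end Summit.SmoothPoincare4.SmoothPoincare4.Theorems.DcrGap.MkFriends

end
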